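import Literature.MathematicalPhysics.QuantumFieldTheory.Balaban1983to89.T4HistoryLipschitzCubeGeometry

/-!
# T4HistoryLipschitzSegment (v1.4) — the outer constant of the NE9 step inequality WITHOUT A BALL OF ANALYTICITY: a TWO-POINT
Kotecký–Preiss binder (`TwoPointKP`: uniform bound AND Lipschitz bound of the activities by ONE majorant on an admissible SET
of potential configurations, with a LIPSCHITZ SCALE `lip k` per step) gives `OutputLipschitz … (fun k => 4·lip k·B₀ k)`
through the tree's pinned activity-Lipschitz theorem for truncated weights under a common majorant
(`T4ActivityLipschitz.norm_clusterSum_sub_le_of_majorant`) — no radius `R₀`, no margin `R₀ − s₀`, no Cauchy estimate (the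
sibling's inverse margin `1/(R₀ − s₀)` ↦ the scale `lip k`); and for the AVERAGED EXP-LINEAR activities of the sibling leaf (the
shape of a term of [II] (2.14)) the two-point binder follows from the SEGMENT bound `‖e^a − e^b‖ ≤ max(e^{Re a}, e^{Re b})·‖a
− b‖` under a PARAMETER-DEPENDENT exponent bound `Re ℓ_ω(Q) ≤ e(ω)` on the admissible set — the literal shape of the printed
majorant step (2.15) → (2.20) → (2.23), where the bound of the last exponential DEPENDS ON THE FLUCTUATION FIELD and is
absorbed into the Gaussian measure (cell `pub-balaban`, T4-DAG §2 node U3 / §5 row T4-U3.E / §6 NE9; seat NE9-P2 gens 8–10,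
census T27–T30; GAPS G-ne9p2-5 / G-ne9p2-3 re-typed, see the end of this docstring; v1.2 adds the JOINT SIZE
INDUCTION §9 deriving the box occupation of the occurring tables — the printed mechanism of [II] p. 21; v1.3 adds the PINNED
form (L″) of the scale bound, §11; v1.4 PROVES the pinned combinatorial sum (1.26) on the abstract cube set — the
lattice-animal bound — and derives (L″) from PER-DOMAIN DECAY (L‴) of the coefficient tables, §12).

HONEST FRAMING (T4-DAG PAGE 1).  Rung (B)+1 on a FIXED finite torus — NOT infinite volume, NOT a mass gap, NOT the Clay
problem — and NOT a proof of NE9 for Bałaban's terms.  Every statement about [I] = [Balaban1987RG1] / [II] =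
[Balaban1988RG2Cluster] below is a HYPOTHESIS SHAPE (a `def … : Prop` used as a binder) or a quotation locating the printed
TYPE of such a shape; the theorems are kernel bookkeeping (the mean-value inequality for the complex exponential, Bochner
integration, and the tree's cluster-expansion estimates) over ABSTRACT carriers.  No internally-minted statement and no
disputed step of the manuscripts enters as a fact; the manuscripts are cited only to locate the TYPE of a displayed
hypothesis.  Conditionals BetaPertH, (B), (B^μ) do not occur in this module (they live inside the window `W` and the
binders of whoever instantiates them, cell T4-DAG §6).

WHERE THIS SITS.  `T4HistoryLipschitzActivity` derived `OutputLipschitz … (fun k => 4·B₀ k/(R₀ − s₀))` from POTENTIAL-KP(G):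
activities holomorphic (along lines) in the potential configuration on a BALL `‖Q‖ < R₀` of the table space under a
`Q`-INDEPENDENT Kotecký–Preiss majorant, the occurring configurations having norm `≤ s₀ < R₀`; the Lipschitz factor came
from the Cauchy estimate along the pencil through the two occurring configurations.  Two residues of that route are NOT
PRINTED and were recorded as walls of the seat (GAPS G-ne9p2-5 (i), G-ne9p2-3): the majorant must be UNIFORM OVER THE BALL
of radius `R₀ > s₀` — print bounds the (2.14) terms for ONE table, Bałaban's `𝐕_k`, through its size (1.36) — and the
memory fades only under the radius inequality `4Bτ̄ < (R₀ − s₀)(1 − ω)`.  Both are artefacts of the Cauchy estimate, not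
of the problem: the tree's engine `T4ActivityLipschitz.norm_clusterSum_sub_le_of_majorant` needs NO holomorphy — only a
common KP majorant `m` of the two activity families with `‖w_A − w_B‖ ≤ ε·m` — and for activities of the (2.14) shape the
factor `ε = ‖Q − Q′‖` comes from the segment between the two configurations inside the exponential, where print's own
majorant lives.

WHAT IS PRINTED (renders of [II], journal page = render number).  (2.14) p. 15: the old terms enter a term of `H(Z)` only
through the last factor «(−1)^{|P|}χ_{k,Y₀}(B)χ^c_{k,P}(B) exp[Σ_{Y∈𝐃} τ(Y)𝐕_k(Y,B)]»; (2.15) p. 15 replaces it by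
«χ_{k,Y₀}χ^c_{k,P} exp[Σ_{Y∈𝐃} |τ(Y)||𝐕_k(Y,B)|]» — the modulus of the exponential of a functional LINEAR in the table,
bounded by the exponential of a B-DEPENDENT bound of its real part; p. 16 «The expression in the last exponential can be
estimated using (1.42), and the inequalities (1.43), (1.36).», with the contour radii (2.18) «1/|τ(Y)| = E₀ε₁C₁α₄⁻¹M^q
exp C₂κ₁ exp(−(1−3δ)κd_k(Y))» and the resulting bound (2.20) p. 16 «Σ_{Y∈𝐃}|τ(Y)||𝐕_k(Y,B)| ≤ … ≤ ½O(1)α₄ Σ_{b⊂Y₀}|B(b)|²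
+ O(1)α₄M⁻⁴|Y₀|» — a bound depending on the fluctuation field `B`, which p. 17 absorbs into the Gaussian measure: (2.23)
«∫dμ₀(X)|_Z exp(−½⟨Γ_k(Z₀,0)X, C^{(k)}(Z₀,0)Γ_k(Z₀,0)X⟩ + ½α₅‖ZX‖²)·∫dμ_{C^{(k)}(Z₀0)}(B) exp(−⟨B,Γ_k(Z₀,0)X⟩ +
½α₅‖Z₀B‖²)», p. 17 «It is a Gaussian integral, and can be easily calculated.», «Of course we have assumed that α₅ is
sufficiently small, e.g. α₅‖C^{(k)}(Z₀,0)‖ < ½.»; the outcome is (2.26) p. 17 and, after resummation, Lemma 3 (2.38) p. 20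
«|H(Z)| ≤ C₃ε₁ exp(−(1 − 8δ)½Lκd_{k+1}(Z))», and p. 20 «The above lemma implies that sufficient conditions for convergence
of the series (2.12), (2.13) are satisfied, see [26, 67, 25, 50].»  THIS SEAT'S READING (a reading, not a fact): (a) the
admissible configurations are a componentwise BOX of tables obeying the size bounds (1.36)/(1.42)–(1.43) — not a norm ball —
and on that box the real part of the exponent is bounded by a FIELD-DEPENDENT quantity `e(ω)` ((2.20)), integrable against
the prefactor and the Gaussian measure under the printed smallness of α₅ ((2.23)–(2.25)); (b) nothing in (2.15)–(2.26) is a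
sup over a ball of tables, and nothing is a Cauchy estimate in the table.  The binder of this leaf displays exactly (a).

WHAT THIS LEAF PROVES (kernel; every decl docstring says which print TYPE it models).
(§1) [folklore] `norm_cexp_sub_cexp_le`: `‖e^a − e^b‖ ≤ max(e^{Re a}, e^{Re b})·‖a − b‖` (mean-value inequality on the segment,
`Convex.norm_image_sub_le_of_norm_deriv_le`, `‖exp z‖ = e^{Re z}` and convexity of `t ↦ e^t`).
(§2) [folklore] For integrands `pre(ω)·exp(ℓ_ω Q)` with `Re ℓ_ω(Q) ≤ e(ω)` on the admissible set and `‖ℓ_ω‖ ≤ l(ω)`: the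
uniform bound `‖∫ pre·e^{ℓQ} dμ‖ ≤ ∫ ‖pre‖e^{e} dμ` (`norm_integral_const_mul_cexp_le_of_re_le`) and the two-point bound
`‖∫ pre·e^{ℓQ} dμ − ∫ pre·e^{ℓQ′} dμ‖ ≤ (∫ ‖pre‖·l·e^{e} dμ)·‖Q − Q′‖` (`norm_integral_const_mul_cexp_sub_le`) under a.e.-strong
measurability of the prefactor, SCALAR measurability of the functionals and the two displayed integrabilities (Bochner
checklist: no bare `∫` of a non-integrable function is used — `integral_sub` is applied to integrands dominated by the first).
(§3) The binder `TwoPointKP G W act 𝒜 n lip a d` (HYPOTHESIS SHAPE): on the window, at every occurring coupling `g k`,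
background and scale-(k+1) domain, for admissible configurations `Q, Q′ ∈ 𝒜 k`: `‖act Q γ‖ ≤ n γ`, `‖act Q γ − act Q′ γ‖ ≤
lip k·‖Q − Q′‖·n γ` on the step volume (nonnegative Lipschitz scale `lip k` — TYPE: the radii (2.18) summed against the table
weights (1.36), `O(α₄)` in print's letters), and the `d`-weighted KP inequality for `2n` with size function `a`.  Consequences
by the tree's engine: `‖newTerm Q − newTerm Q′‖ ≤ 4·lip k·‖Q − Q′‖·a(pin X)e^{−δ(X)}` (`norm_newTerm_sub_le_of_twoPointKP`), hence
with `DecayExtract`, `PinBudget`, the reading map and «occurring configurations are admissible»: `OutputLipschitz E W T Ψ κ wt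
(fun k => 4·lip k·B₀ k)` (`outputLipschitz_of_twoPointKP`) — NO radius, NO margin — and by name `outerLipschitz_of_twoPointKP`,
`ne9_and_fadingMemory_of_twoPointKP_perStep` (`T4HistoryLipschitzRecursion.ne9_and_fadingMemory_of_perStepNN`): with `lip k ≤
lipbar`, NE9 with the product moduli of rate `ω + 4·lipbar·B·τ̄` and `FadingMemory` of the same rate; the memory fades iff
`ω + 4·lipbar·B·τ̄ < 1` (radius-free form of GAPS G-ne9p2-3; still a condition on letters not printed for differences).
(§4) `twoPointKP_of_avgExpLinear`: the averaged exp-linear activities `G.avgExpLinearAct μ pre lin` of the sibling leaf satisfy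
`TwoPointKP` on admissible sets `𝒜 k` with the SEGMENT MAJORANT `segMajorant = ∫‖pre‖e^{e}dμ + (lip k)⁻¹∫‖pre‖·l·e^{e}dμ`
(`≤ 2∫‖pre‖e^{e}dμ` when `l ≤ lip k`, `segMajorant_le_two_mul`), GIVEN: a.e.-strongly measurable prefactors, scalarly
measurable functionals with pointwise norm bounds `l`, the exponent bound `Re ℓ_ω(Q) ≤ e(ω)` on `𝒜 k`, positive scales, the
two integrabilities, and the displayed KP inequality for `2·segMajorant`.
(§5) With a support map (`T4HistoryLipschitzEntropy.Supported`) the KP inequality follows from DECAY of the segment majorant,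
`segMajorant ≤ ε k·y^{|supp|}` on step volumes at occurring couplings, and the smallness `y·e^{a₁+d₁}e^{Dθ} ≤ θ`,
`2ε k·θ·(D + 1) ≤ a₁` (`twoPointKP_of_avgExpLinear_decay`, ∘ `Supported.kpClause_of_decay`).
(§6) THE BOX INSTANCE on the table space `Sp →ᵇ ℂ` with evaluation-type functionals `T ↦ Σ_Y c_ω(Y)·T(pt_ω(Y))` of the
sibling leaf: admissible sets `boxSet (β k) = {T | ∀ x, ‖T x‖ ≤ β k x}` (componentwise size bounds — the TYPE of (1.36) /
(1.42)–(1.43), field-point by field-point; a norm ball is the special case of constant `β`, `closedBall_subset_boxSet`), norm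
bounds `l = Σ_Y ‖c_ω(Y)‖`, exponent bounds `e = Σ_Y ‖c_ω(Y)‖·β k (pt_ω Y)` (the TYPE of (2.20): radii × pointwise sizes),
both measurable by construction; `twoPointKP_of_avgEvalExpLinear_box(_decay)`.
(§7) END-TO-END on a cube chart (`T4HistoryLipschitzCubeGeometry.CubeChart`, geometry constructed):
`cubeChart_ne9_and_fadingMemory_of_box` — NE9 ∧ FadingMemory with rate `ω + 4·lipbar·a₁·τ̄`, the sibling's K2 theorem
`CubeChart.ne9_and_fadingMemory_of_decay` (rate `ω + 4a₁τ̄/(R₀ − s₀)`) with BALL ↦ BOX, `1/(R₀ − s₀)` ↦ `lipbar`,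
`Integrable pre` ↦ the two integrabilities, and the hypotheses `s₀ < R₀`, `0 ≤ R₀` GONE.
(§7b, v1.1) `cubeChart_ne9_and_fadingMemory_of_boxMajorant` — §7 with the activity side reduced to ONE integrability, (L′) a
scale bound `Σ_Y ‖c_ω(Y)‖ ≤ lip k·#cubes(γ)` (TYPE (2.18) × (1.36) summed by (2.19)) and (A″) the decay of the BOX MAJORANT
`∫‖pre‖e^{boxExponent}dμ ≤ ε k·y^{#cubes}` — the (2.26)-TYPE majorant itself; via `segMajorant_le_one_add_mul` (`segMajorant ≤
(1 + L)·∫‖pre‖e^{e}dμ` when `l ≤ lip k·L`), `integrable_weighted_of_le`, `one_add_mul_pow_le` (`(1 + n)yⁿ ≤ (2y)ⁿ`).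
(§8) NON-VACUITY of `TwoPointKP` and of §3 on the nonlinear toy recursion of the sibling leaf (one polymer, linear activity
`μQ`, `E_{k+1} = g_k + Re Φ^T({∙}; μE_k)`): `kpToy_twoPointKP`, `kpToy_outputLipschitz_twoPoint`.
(§9, v1.2) THE JOINT SIZE INDUCTION `termSize_of_recursion` — the printed mechanism of [II] p. 21 («The inequality (2.41)
and the assumptions imply the inequality (I.1.18), with ½E₀ instead of E₀, for the terms of the effective action
𝐄^{(k+1)} in (I.1.3).», «We define ½E₀ as equal to this constant»), typed over the binders: from `AdmissibleTerms`,
`ChannelSizeNN` (∘ `channelSizeNN_of_perStepNN`), `Factorises`, TWO-POINT KP (its UNIFORM clause only, through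
`norm_newTerm_le_of_twoPointKP` — TYPE (2.41)), `DecayExtract`, `PinBudget … B₀ κ` and the displayed data (B0) a base size at
scale 0 (TYPE (0.23) p. 256 of [I]: nothing is created before the first step), (X) a window-uniform bound `e^{−κd}·p₀ k` of
the TABLE-INDEPENDENT part `Ψ k (g k) P − Re newTerm(ρ k P)` of the new term (TYPE: the contributions to 𝐄^{(k+1)} not
produced by the cluster expansion in the old tables — in print the added expression `[log Z^{(k)}(U_{k+1}) − log Z^{(k)}(1)]`
of p. 21 with its «absolute constant» ½E₀ ([I] p. 261: «the expansion of the log Z^{(j−1)}(U_j) constructed in [16]»); the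
identification is this seat's READING, displayed; table-independent by `explicitPart_indep` under the cluster-sum
factorisation, so a bound at one reference output suffices, `explicitBound_of_reference`), (N) a profile
`N ≥ 0` with `p₀ j + B₀ j ≤ N (j+1)` (TYPE `½E₀ + ½E₀ = E₀`), (R′) the read-out `ρ k` maps the weighted output box of radius
`sizeRadius τ N k = Σ_{j≤k} τ k j·N j` INTO the admissible set `𝒜 k` (TYPE (2.19)–(2.20) p. 16; uniform radius
`τ̄N̄/(1 − ω)` by `sizeRadius_le_of_geometric` / `boxRead_of_uniformRadius`, print's «the sum over j is bounded by 2(6L)⁴»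
p. 8): by strong induction on the creation step, `TermSize E W κ N` (`|E g U X| ≤ e^{−κd_X}·N(scale X)` — TYPE (I.1.18) =
[I] (1.18) p. 263, for EVERY history of the window) AND the admissibility of every occurring output configuration
`ρ k (T k g′ (E g))`, `g, g′ ∈ W` — the HYBRID ones included (the comparison history enters only through the channel, and
`ChannelSizeNN` quantifies over it) — i.e. the occupation hypothesis `hocc` of §3/§7/§7b, DERIVED.
(§9b) `cubeChart_termSize_and_boxOcc`, `cubeChart_ne9_and_fadingMemory_of_sizeInduction` — §7b on a cube chart with `hocc`
REPLACED by (B0), (X), (N) (`p₀ j + a₁ ≤ N (j+1)`, the chart's pin budget being the constant `a₁`), (R′) (pointwise into the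
box `β k`); same moduli `ℓ·∏(ω + 4·lipbar·a₁·τ̄)`, same fading condition.
(§10) NON-VACUITY of §9 on the toy: `kpToy_termSize` RE-DERIVES the occupation `|tables| ≤ 3/2 = ½ + 1·1` of
`T4HistoryLipschitzActivity.kpToy_occ` (there by hand) from `termSize_of_recursion` with every binder inhabited
(`p₀ ≡ ½` = the coupling bound of the window, `B₀ ≡ 1`, `N 0 = 0`, `N (j+1) = 3/2`) — the statement of `kpToy_occ` itself is
not re-landed (it is importable; `mem_closedBall_zero_iff.1 ((kpToy_termSize hμ hμ1 hW).2 g hg g' hg' k)` re-proves it).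
(§11, v1.3) THE PINNED FORM OF THE SCALE BOUND: `sum_le_mul_card_of_pinned` (double counting over the cubes of the
polymer) and `coeffSum_le_of_pinned` — (L″) «at every cube `x ∈ γ`, `Σ_{Y : x ∈ dom Y} ‖c_ω(Y)‖ ≤ lip k`» for coefficients
supported on domains MEETING the polymer implies (L′) `coeffSum ≤ lip k·#cubes(γ)` — and the END-TO-END
`cubeChart_ne9_and_fadingMemory_of_pinned` = §9b with `hL` REPLACED by the domain map `dom`, the support condition `hmeet` and
the pinned bound `hpin` (local, one inequality per cube).  TYPE of (L″): the pinned combinatorial sums of [II] — p. 8 (1.26)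
«Σ_{X∈𝐃_j,X⊃□′} exp(−κd_j(X)) ≦ O(1)» («This inequality was used many times in convergence proofs for cluster
expansions»), and p. 16 after (2.19), «resummed over all Y∈𝐃_k containing, for example, the point b_−», «this yields a
constant O(1)», whose total over the family is the last term «+ O(1)α₄M^{−4}|Y₀|» of (2.20); TYPE of `hmeet`: p. 17 «𝐃_i satisfy
∪_{Y∈𝐃_i} Y = Y_i» (the domains of the family lie in the polymer).  The radii (2.18) and the normalisation of the table
coordinates that make the pinned sums `O(α₄)` are the instantiator's; (L″) is displayed, not asserted.
(§12, v1.4) THE PINNED SUM (1.26) PROVED: `pinnedSum_le_of_domainDecay` — on an abstract cube set with an adjacency of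
degree `≤ D`, weights `w Y ≤ αc·y₁^{#dom Y}` on CONNECTED, injectively labelled domains have pinned sums `Σ_{Y : x ∈ dom Y}
w Y ≤ αc·θ₁` at every cube whenever `y₁·e^{D·θ₁} ≤ θ₁` (the domains through `x` inject into the connected cube families rooted
at `x`; the tree's lattice-animal bound `Polymer.sum_isConn_pow_card_le`, [FriedliVelenik2017] Lemma 3.38, through
`T4HistoryLipschitzEntropy.sum_isConn_mul_pow_card_le`); the literal shape on the chart's own localization domains
`sum_connFamilies_pinned_le` (`Σ_{Y ∈ connFamilies adj R, x ∈ Y} y₁^{#Y} ≤ θ₁`) and its torus instance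
`torus_sum_connFamilies_pinned_le` (wall adjacency of `Fin ν → ZMod N`, degree `2ν`); `pin_of_domainDecay` — (L‴) PER-DOMAIN
DECAY `‖c_ω(Y)‖ ≤ αc k·y₁^{#dom Y}` + connected nonempty domains + injective labelling + `αc k·θ₁ ≤ lip k` GIVE (L″); and the
END-TO-END `cubeChart_ne9_and_fadingMemory_of_domainDecay` = §11 with `hpin` REPLACED by (L‴) and these structural data, the
degree being the chart's `deg`.  TYPE: the pinned sum is [II] (1.26) p. 8 = the middle inequality of [I] (0.26) p. 257
«Σ_{j=1}^k Σ_{X∈𝐃_j} E₀ exp(−κd_j(X)) ≦ Σ_{j=1}^k Σ_{□∈π_j} Σ_{X∈𝐃_j,X⊃□} E₀ exp(−κd_j(X)) ≦ Σ_{j=1}^k Σ_{□∈π_j} E₀O(1)»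
(whose first inequality is the double counting of §11), which [II] p. 8 imports from the cluster-expansion literature («This
inequality was used many times in convergence proofs for cluster expansions, for example see [48, 50, 40, 26, 3].») — HERE A
THEOREM over the abstract cube set, with decay in the number of cubes in place of `exp(−κd_j(X))` ((2.30) p. 18 «(3·2³)⁻¹M⁻⁴|Y|
≦ d_k(Y)», «holding for localization domains Y∈𝐃_k»; (1.28) p. 8 «M^{−4}|Y| ≦ 3·2³d_k(Y)»); TYPE of (L‴): the summand «+ Σ_{Y∈𝐃}
α₄ exp(−δκd_k(Y))» of (2.20) p. 16 (radius (2.18) × table size (1.36); print continues «Using (1.28) we obtain» (2.20), whose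
last term «+ O(1)α₄M^{−4}|Y₀|» is the total); TYPE of connectedness: [I] p. 257 («Such a domain is a union of a connected,
finite family of cubes from π_j»).  The radii and the normalisation of the table coordinates remain the instantiator's; (L‴)
is displayed, not asserted.

WHAT IS STILL NOT PRINTED (GAPS G-ne9p2-5 re-typed, not closed; recorded as such).  (i′) the DECAY of the segment majorant
in the support size, `∫‖pre‖(1 + l/lip k)e^{e}dμ ≤ ε k·y^{#cubes}`, for the (2.14) activities read as functions on the BOX of
tables obeying (1.36) — by §7b it follows from (i″) the decay of the BOX MAJORANT `∫‖pre‖e^{e}dμ` alone (+ the scale bound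
(L′) of TYPE (2.18)–(2.19)); print proves the bound of this TYPE ((2.26) → (2.38)) for the one table `𝐕_k`, and the reading
(a) above says the printed chain uses only the box bounds, but the uniformity is this seat's reading, displayed as a hypothesis;
(ii) the pin-budget letter `B₀ = a₁` for DIFFERENCES, the bound `lipbar` of the scales, and (iii) the fading condition
`ω + 4·lipbar·a₁·τ̄ < 1` (G-ne9p2-3, radius-free); (iv) NE9-LAST (`LastCouplingLipschitz`, wall (L) of the record) and the
channel binders are untouched by this leaf.
(v, v1.2) the OCCUPATION of the box by the occurring hybrid tables `T k g′ (E g)` (G-ne9p2-5 residual (iv) of UPDATE-2/3: a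
history-uniform bound of TYPE (1.36)/(I.1.18), displayed as `hocc` in v1–v1.1) is NO LONGER a hypothesis of the end-to-end
theorem: §9 derives it, together with the (I.1.18)-type bound for every history, from (B0), (X), (N), (R′) by the printed
induction of p. 21.  Of these, (B0) is the TYPE of (0.23) p. 256 of [I]; (X) and (N) are printed in TYPE (p. 21: the bound of
the added expression by an absolute constant ½E₀, and `O(1)C₃ε₁ ≦ ½E₀`) — as statements about ONE history at a time; the
residual READING is (X′): that the table-independent part of the actual recursion is that added expression (nothing else
enters 𝐄^{(k+1)} outside the cluster expansion (2.40)) and that its constant `p₀ k` is uniform in the explicit coupling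
`g k` over the window; (R′) is a compatibility
of the CHOSEN box profile `β k` with the channel weights `wt k`, discharged when the chart is instantiated (print: (1.36) is
the definition of the box).  The hybrid configurations cost nothing extra: the comparison history enters `T k g′ (E g)` only
through the channel, over whose history argument `ChannelSizeNN` (reading G-ne9p2-4, displayed since v1 of the sibling
leaf) already quantifies.
(vi, v1.3) the scale bound (L′) may now be displayed in the PINNED form (L″) (`cubeChart_ne9_and_fadingMemory_of_pinned`):
local — one inequality per cube of the polymer — and of the printed TYPE (1.26) p. 8 / p. 16; it remains a hypothesis on the
instantiator's coefficient tables (radii × normalisation), and (i″) is unchanged.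
(vii, v1.4) the pinned bound (L″) is NO LONGER a hypothesis of the end-to-end theorem
(`cubeChart_ne9_and_fadingMemory_of_domainDecay`): §12 derives it from (L‴) — one inequality per DOMAIN, `‖c_ω(Y)‖ ≤ αc
k·y₁^{#dom Y}`, the printed per-domain weight of (2.20) in the instantiator's normalisation — plus the connectedness and the
injective labelling of the domains, by the lattice-animal bound; the combinatorial content of (1.26) is thereby kernel-proved
on the abstract cube set.  What (L‴) still displays is the instantiator's: the radii (2.18), the normalisation by the sizes
(1.36), and the conversion of `exp(−δκd_k(Y))` into `y₁^{#cubes}` by (2.30); (i″), (L), G-ne9p2-4, (C) are unchanged.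
DELTA against the sibling leaves (census T17–T19, K2): no ball, no `R₀ > s₀`, no holomorphy hypothesis of any kind, prefactor
integrability weakened to measurability + the two weighted integrabilities, exponent bound parameter-dependent as in (2.20);
the sibling's inverse margin `1/(R₀ − s₀)` becomes the Lipschitz scale `lip k` of the functionals (same order, `O(α₄)`, when
`R₀` is taken of the order of the inverse functional norm), now WITHOUT the ball-uniformity it cost.  Value = typed reduction
one step closer to the printed chain + kernel bookkeeping; NOT summit progress.

VERSIONS.  v1 (p190696, commit 3dfa34aa965e): §1–§7, §8.  v1.1 (p190781, commit 95055b18017e): + §7b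
(`one_add_mul_pow_le`, `segMajorant_le_one_add_mul`, `integrable_weighted_of_le`, `coeffSum_nonneg`,
`aestronglyMeasurable_coeffSum`, `cubeChart_ne9_and_fadingMemory_of_boxMajorant`) and this paragraph + the (§7b)/(i″) header
clauses; §1–§8 of v1 byte-unchanged (append-only).  v1.2 (p191161, commit 5d7131800bd3): + §9/§9b/§10 (`TermSize`, `sizeRadius`,
`sizeRadius_nonneg`, `sizeRadius_le_of_geometric`, `channelOutput_le_of_sizes`, `boxRead_of_uniformRadius`,
`explicitPart_indep`, `explicitBound_of_reference`, `termSize_of_recursion`, `cubeChart_termSize_and_boxOcc`,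
`cubeChart_ne9_and_fadingMemory_of_sizeInduction`, `sizeRadius_diag`, `kpToy_termSize`), the
(§9)–(§10)/(v) header clauses, and DOCFIX D-1 (XREAD C-ref6-158 / C-ne4p1-29: the bound `E₀ exp(−κd_j(X))` of the
effective-action terms is [I] (0.25) p. 257 / (1.18) p. 263, whereas Lemma 1 (1.36) p. 9 of [II] is the table bound
«|𝐕′_k(Y, 𝐔, 𝐉, B)| ≦ E₀ε₁C₁M^q exp C₂κ₁ exp(−(1 − 2δ)κd_k(Y))» — corrected in the `boxSet` docstring and in the References);
every v1.1 declaration byte-unchanged (the DOCSTRING of `boxSet` excepted), append-only.  v1.3 (p191403, commit 5ad13ac6b981): + §11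
(`sum_le_mul_card_of_pinned`, `coeffSum_le_of_pinned`, `cubeChart_ne9_and_fadingMemory_of_pinned`), the (§11)/(vi) header clauses
and the p. 8 / p. 16 / p. 17 locators in the References; every v1.2 declaration byte-unchanged, append-only.  v1.4 (this file): + §12
(`pinnedSum_le_of_domainDecay`, `sum_connFamilies_pinned_le`, `torus_sum_connFamilies_pinned_le`, `pin_of_domainDecay`,
`cubeChart_ne9_and_fadingMemory_of_domainDecay`), the (§12)/(vii) header clauses, and in the References the [I] (0.26) p. 257 / p. 261
and [II] (1.28) p. 8 locators and [FriedliVelenik2017] (XREAD C-an4-44, INFO I1/I2); every v1.3 declaration byte-unchanged, append-only.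

References: [Balaban1988RG2Cluster] T. Bałaban, Renormalization group approach to lattice gauge field theories. II,
Comm. Math. Phys. 116 (1988) 1–22, p. 8 ((1.26), (1.28) and «the sum over j is bounded by 2(6L)⁴»), Lemma 1 (1.33)–(1.36) p. 9 (the
table bounds), (2.13)–(2.15) pp. 14–15, (2.18)–(2.20) and the resummation sentence after (2.19) p. 16, (2.23)–(2.26) and the
«𝐃 = ∪𝐃_i» sentence p. 17, (2.30) p. 18, Lemma 3 (2.38) p. 20, (2.40)–(2.41)
and the closing paragraph p. 21; [Balaban1987RG1] part I, Comm. Math. Phys. 109 (1987) 249–301, (0.23) p. 256, (0.25) p. 257,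
(1.18) p. 263 (the inductive size bounds of the effective-action terms), p. 257 (localization domains = connected cube families;
(0.26): the double counting over cubes and the pinned sum), p. 261 («the expansion of the log Z^{(j−1)}(U_j) constructed in
[16]»); [KoteckyPreiss1986] R. Kotecký, D. Preiss, Comm. Math. Phys. 103 (1986) 491–498, (1)–(3); [FriedliVelenik2017] S. Friedli,
Y. Velenik, Statistical Mechanics of Lattice Systems (CUP 2017), Lemma 3.38 (the lattice-animal bound, in the tree as
`PolymerCombinatorics.Polymer.sum_isConn_pow_card_le`).
-/

noncomputable section

namespace Literature.MathematicalPhysics.QuantumFieldTheory.Balaban1983to89.T4HistoryLipschitzSegment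

open scoped BigOperators
open Metric Set MeasureTheory
open Literature.Probability.LatticeModels
open Literature.MathematicalPhysics.QuantumFieldTheory.Balaban1983to89.T4OutputRate
open Literature.MathematicalPhysics.QuantumFieldTheory.Balaban1983to89.T4ActivityLipschitz
open Literature.MathematicalPhysics.QuantumFieldTheory.Balaban1983to89.T4HistoryLipschitzRecursion
open Literature.MathematicalPhysics.QuantumFieldTheory.Balaban1983to89.T4HistoryLipschitzOuter
open Literature.MathematicalPhysics.QuantumFieldTheory.Balaban1983to89.T4HistoryLipschitzActivity
open Literature.MathematicalPhysics.QuantumFieldTheory.Balaban1983to89.T4HistoryLipschitzEntropy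
open Literature.MathematicalPhysics.QuantumFieldTheory.Balaban1983to89.T4HistoryLipschitzCubeGeometry
open Literature.MathematicalPhysics.QuantumFieldTheory.Balaban1983to89.T4HistoryLipschitzActivity (ClusterGeom)

/-! ## §1 The segment bound for the complex exponential -/

/-- **SEGMENT BOUND** `‖e^a − e^b‖ ≤ max(e^{Re a}, e^{Re b})·‖a − b‖`: the mean-value inequality for `exp` on the segment
`[b, a]`, the derivative `exp` having norm `e^{Re z} ≤ max(e^{Re a}, e^{Re b})` there by convexity of `t ↦ e^t`. [folklore] -/
theorem norm_cexp_sub_cexp_le (a b : ℂ) :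
    ‖Complex.exp a - Complex.exp b‖ ≤ max (Real.exp a.re) (Real.exp b.re) * ‖a - b‖ := by
  have hs : Convex ℝ (segment ℝ b a) := convex_segment b a
  refine hs.norm_image_sub_le_of_norm_deriv_le (f := Complex.exp) (𝕜 := ℂ)
    (fun x _ => Complex.differentiable_exp.differentiableAt) ?_ (left_mem_segment ℝ b a) (right_mem_segment ℝ b a)
  intro x hx
  rw [Complex.deriv_exp, Complex.norm_exp]
  obtain ⟨p, q, hp, hq, hpq, rfl⟩ := hx
  have hre : (p • b + q • a).re = p * b.re + q * a.re := by simp [Complex.add_re]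
  rw [hre, Real.exp_monotone.map_max.symm, Real.exp_le_exp]
  calc p * b.re + q * a.re ≤ p * max a.re b.re + q * max a.re b.re :=
        add_le_add (mul_le_mul_of_nonneg_left (le_max_right _ _) hp)
          (mul_le_mul_of_nonneg_left (le_max_left _ _) hq)
    _ = max a.re b.re := by rw [← add_mul, hpq, one_mul]

/-! ## §2 Integrands «prefactor × exp(linear functional)» under an exponent bound: uniform and two-point bounds, pointwise
and averaged (the (2.14) → (2.15) → (2.23) step of [II] in kernel, with the fluctuation integral) -/

section Integrands

variable {Pot : Type*} [NormedAddCommGroup Pot] [NormedSpace ℂ Pot] {Ω : Type*} [MeasurableSpace Ω]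

/-- `‖c·e^{ℓ Q}‖ = ‖c‖·e^{Re ℓ Q}` — the identity behind (2.14) → (2.15) «exp[Σ τ(Y)𝐕_k(Y,B)]» ↦ «exp[Σ |τ(Y)||𝐕_k(Y,B)|]».
[folklore] -/
theorem norm_const_mul_cexp (c : ℂ) (ℓ : Pot →L[ℂ] ℂ) (Q : Pot) :
    ‖c * Complex.exp (ℓ Q)‖ = ‖c‖ * Real.exp (ℓ Q).re := by
  rw [norm_mul, Complex.norm_exp]

/-- UNIFORM BOUND of the integrand under an exponent bound `Re ℓ Q ≤ e`. [folklore] -/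
theorem norm_const_mul_cexp_le_of_re_le {c : ℂ} {ℓ : Pot →L[ℂ] ℂ} {Q : Pot} {e : ℝ} (h : (ℓ Q).re ≤ e) :
    ‖c * Complex.exp (ℓ Q)‖ ≤ ‖c‖ * Real.exp e := by
  rw [norm_const_mul_cexp]
  exact mul_le_mul_of_nonneg_left (Real.exp_le_exp.2 h) (norm_nonneg _)

/-- TWO-POINT BOUND of the integrand: for `‖ℓ‖ ≤ l` and two configurations with `Re ℓ Q, Re ℓ Q′ ≤ e`,
`‖c·e^{ℓQ} − c·e^{ℓQ′}‖ ≤ ‖c‖·l·e^{e}·‖Q − Q′‖` (§1 on the segment `[ℓ Q′, ℓ Q]`). [folklore] -/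
theorem norm_const_mul_cexp_sub_le {c : ℂ} {ℓ : Pot →L[ℂ] ℂ} {l e : ℝ} (hl : ‖ℓ‖ ≤ l) {Q Q' : Pot}
    (hQ : (ℓ Q).re ≤ e) (hQ' : (ℓ Q').re ≤ e) :
    ‖c * Complex.exp (ℓ Q) - c * Complex.exp (ℓ Q')‖ ≤ ‖c‖ * l * Real.exp e * ‖Q - Q'‖ := by
  rw [← mul_sub, norm_mul]
  have h1 := norm_cexp_sub_cexp_le (ℓ Q) (ℓ Q')
  have hmax : max (Real.exp (ℓ Q).re) (Real.exp (ℓ Q').re) ≤ Real.exp e :=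
    max_le (Real.exp_le_exp.2 hQ) (Real.exp_le_exp.2 hQ')
  have h2 : ‖ℓ Q - ℓ Q'‖ ≤ l * ‖Q - Q'‖ := by
    rw [← map_sub]
    exact (ℓ.le_opNorm _).trans (mul_le_mul_of_nonneg_right hl (norm_nonneg _))
  calc ‖c‖ * ‖Complex.exp (ℓ Q) - Complex.exp (ℓ Q')‖ ≤ ‖c‖ * (Real.exp e * (l * ‖Q - Q'‖)) :=
        mul_le_mul_of_nonneg_left (h1.trans (mul_le_mul hmax h2 (norm_nonneg _) (Real.exp_pos _).le))
          (norm_nonneg _)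
    _ = ‖c‖ * l * Real.exp e * ‖Q - Q'‖ := by ring

/-- INTEGRABILITY of the integrand at an admissible configuration, from a.e.-strong measurability of the prefactor, scalar
measurability of the functionals and integrability of the dominating `‖pre‖·e^{e}` — the TYPE of [II] p. 17 «It is a
Gaussian integral, and can be easily calculated.» under «α₅‖C^{(k)}(Z₀,0)‖ < ½». [cite: Balaban1988RG2Cluster, (2.23)-(2.25) p.17] -/
theorem integrable_const_mul_cexp_of_re_le {μ : Measure Ω} {pre : Ω → ℂ} {lin : Ω → (Pot →L[ℂ] ℂ)} {e : Ω → ℝ}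
    (hpre : AEStronglyMeasurable pre μ) {Q : Pot} (hlinQ : AEStronglyMeasurable (fun ω => lin ω Q) μ)
    (hint : Integrable (fun ω => ‖pre ω‖ * Real.exp (e ω)) μ) (hQ : ∀ ω, (lin ω Q).re ≤ e ω) :
    Integrable (fun ω => pre ω * Complex.exp (lin ω Q)) μ :=
  hint.mono' (hpre.mul (Complex.continuous_exp.comp_aestronglyMeasurable hlinQ))
    (Filter.Eventually.of_forall fun ω => norm_const_mul_cexp_le_of_re_le (hQ ω))

/-- **AVERAGED UNIFORM BOUND**: `‖∫ pre·e^{ℓ Q} dμ‖ ≤ ∫ ‖pre‖·e^{e} dμ` for an admissible `Q` — the shape of (2.15) →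
(2.26) with the field-dependent exponent bound (2.20) integrated against the Gaussian measure (2.23). [cite: Balaban1988RG2Cluster, (2.15) p.15, (2.20) p.16, (2.23)-(2.26) p.17] -/
theorem norm_integral_const_mul_cexp_le_of_re_le {μ : Measure Ω} {pre : Ω → ℂ} {lin : Ω → (Pot →L[ℂ] ℂ)}
    {e : Ω → ℝ} (hint : Integrable (fun ω => ‖pre ω‖ * Real.exp (e ω)) μ) {Q : Pot}
    (hQ : ∀ ω, (lin ω Q).re ≤ e ω) :
    ‖∫ ω, pre ω * Complex.exp (lin ω Q) ∂μ‖ ≤ ∫ ω, ‖pre ω‖ * Real.exp (e ω) ∂μ :=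
  norm_integral_le_of_norm_le hint (Filter.Eventually.of_forall fun ω => norm_const_mul_cexp_le_of_re_le (hQ ω))

/-- **AVERAGED TWO-POINT BOUND**: for two admissible configurations,
`‖∫ pre·e^{ℓQ} dμ − ∫ pre·e^{ℓQ′} dμ‖ ≤ (∫ ‖pre‖·l·e^{e} dμ)·‖Q − Q′‖` — pointwise §1 on the segment inside the exponential,
then Bochner (`integral_sub` on two integrands dominated by `‖pre‖e^{e}`, `norm_integral_le_of_norm_le`). NOT a printed
statement (print compares no two tables); its INPUTS are of the printed types of (2.15)/(2.18)/(2.20)/(2.23). [folklore] -/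
theorem norm_integral_const_mul_cexp_sub_le {μ : Measure Ω} {pre : Ω → ℂ} {lin : Ω → (Pot →L[ℂ] ℂ)}
    {l e : Ω → ℝ} (hpre : AEStronglyMeasurable pre μ)
    (hlinw : ∀ Q : Pot, AEStronglyMeasurable (fun ω => lin ω Q) μ) (hl : ∀ ω, ‖lin ω‖ ≤ l ω)
    (hint₀ : Integrable (fun ω => ‖pre ω‖ * Real.exp (e ω)) μ)
    (hint₁ : Integrable (fun ω => ‖pre ω‖ * l ω * Real.exp (e ω)) μ) {Q Q' : Pot}
    (hQ : ∀ ω, (lin ω Q).re ≤ e ω) (hQ' : ∀ ω, (lin ω Q').re ≤ e ω) :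
    ‖(∫ ω, pre ω * Complex.exp (lin ω Q) ∂μ) - ∫ ω, pre ω * Complex.exp (lin ω Q') ∂μ‖ ≤
      (∫ ω, ‖pre ω‖ * l ω * Real.exp (e ω) ∂μ) * ‖Q - Q'‖ := by
  rw [← integral_sub (integrable_const_mul_cexp_of_re_le hpre (hlinw Q) hint₀ hQ)
    (integrable_const_mul_cexp_of_re_le hpre (hlinw Q') hint₀ hQ'), ← integral_mul_const]
  exact norm_integral_le_of_norm_le (hint₁.mul_const _)
    (Filter.Eventually.of_forall fun ω => norm_const_mul_cexp_sub_le (hl ω) (hQ ω) (hQ' ω))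

end Integrands

/-! ## §3 The binder TWO-POINT KP over a cluster geometry, and `OutputLipschitz` WITHOUT a radius -/

section Geometry

variable {C : Carriers} (G : ClusterGeom C) {Bg : Type} {Pot : Type*} [NormedAddCommGroup Pot]

/-- **TWO-POINT KP (HYPOTHESIS SHAPE — asserted nowhere; printed TYPE for ONE table: (2.15)/(2.26)/(2.38) of [II]; the
two-point clause compares two tables and is NOT PRINTED)**: `a, d ≥ 0`, and on the window `W`, at every occurring last
coupling `g k`, background `U` and scale-(k+1) domain `X`, for ADMISSIBLE configurations `Q, Q′ ∈ 𝒜 k`: every activity of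
the step volume is bounded by the configuration-free majorant `n k (g k) U γ`, the difference of the activities at `Q` and
`Q′` is bounded by `lip k·‖Q − Q′‖·n k (g k) U γ` with a nonnegative LIPSCHITZ SCALE `lip k` of the step (TYPE: the contour
radii (2.18) p. 16 summed against the table weights — the inverse of the sibling leaf's analyticity margin), and `2n`
satisfies the `d`-weighted Kotecký–Preiss condition with size function `a` in the step volume.  No ball, no holomorphy.
[cite: Balaban1988RG2Cluster, (2.15) p.15, (2.18) p.16, (2.26) p.17, Lemma 3 (2.38) p.20; KoteckyPreiss1986, (1)-(3)] -/
def TwoPointKP (W : Set (ℕ → ℝ)) (act : ℕ → ℝ → Bg → Pot → G.P → ℂ) (𝒜 : ℕ → Set Pot)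
    (n : ℕ → ℝ → Bg → G.P → ℝ) (lip : ℕ → ℝ) (a d : G.P → ℝ) : Prop :=
  (∀ γ, 0 ≤ a γ) ∧ (∀ γ, 0 ≤ d γ) ∧ (∀ k, 0 ≤ lip k) ∧
    ∀ g ∈ W, ∀ (k : ℕ) (U : Bg) (X : C.Dom), C.scale X = k + 1 →
      (∀ Q ∈ 𝒜 k, ∀ γ ∈ G.vol X, ‖act k (g k) U Q γ‖ ≤ n k (g k) U γ) ∧
      (∀ Q ∈ 𝒜 k, ∀ Q' ∈ 𝒜 k, ∀ γ ∈ G.vol X,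
        ‖act k (g k) U Q γ - act k (g k) U Q' γ‖ ≤ lip k * ‖Q - Q'‖ * n k (g k) U γ) ∧
      (∀ γ ∈ G.vol X, ∑ γ' ∈ G.vol X with G.inc γ' γ, 2 * n k (g k) U γ' * Real.exp (a γ' + d γ') ≤ a γ)

/-- **THE TWO-POINT BOUND OF THE NEW TERM (kernel)**: TWO-POINT KP ∧ DECAY EXTRACTION ⇒ for admissible `Q, Q′`,
`‖newTerm Q − newTerm Q′‖ ≤ 4·(lip k·‖Q − Q′‖)·a(pin X)·e^{−δ(X)}` — the tree's pinned activity-Lipschitz theorem under a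
common majorant (`T4ActivityLipschitz.norm_clusterSum_sub_le_of_majorant`, with `ε = lip k·‖Q − Q′‖`, `m = n`, KP for `2n`),
`L = vol X`, `𝒞 = clus X`. [folklore] -/
theorem norm_newTerm_sub_le_of_twoPointKP {W : Set (ℕ → ℝ)} {act : ℕ → ℝ → Bg → Pot → G.P → ℂ} {𝒜 : ℕ → Set Pot}
    {n : ℕ → ℝ → Bg → G.P → ℝ} {lip : ℕ → ℝ} {a d : G.P → ℝ} (hK : TwoPointKP G W act 𝒜 n lip a d)
    {δ : C.Dom → ℝ} (hdec : G.DecayExtract δ d) {g : ℕ → ℝ} (hg : g ∈ W) {k : ℕ} {U : Bg} {X : C.Dom}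
    (hX : C.scale X = k + 1) {Q Q' : Pot} (hQ : Q ∈ 𝒜 k) (hQ' : Q' ∈ 𝒜 k) :
    ‖G.newTerm act k (g k) U X Q - G.newTerm act k (g k) U X Q'‖ ≤
      4 * (lip k * ‖Q - Q'‖) * a (G.pin X) * Real.exp (-(δ X)) := by
  obtain ⟨ha, hd, hlip0, hP⟩ := hK
  obtain ⟨hbd, hlip, hkp⟩ := hP g hg k U X hX
  exact norm_clusterSum_sub_le_of_majorant (inc := G.inc) ha hd (mul_nonneg (hlip0 k) (norm_nonneg (Q - Q')))
    (fun γ hγ => hbd Q hQ γ hγ) (fun γ hγ => hbd Q' hQ' γ hγ) (fun γ hγ => hlip Q hQ Q' hQ' γ hγ) hkp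
    (G.pin_mem X) (G.clus_sub X) (G.clus_pin X) (hdec X)

/-- **The decay bound of the new term at an admissible configuration (kernel)**: TWO-POINT KP ∧ DECAY ∧ PIN BUDGET ⇒
`‖newTerm Q‖ ≤ B₀ k·e^{−κd(X)}` (the shape of (2.41) p. 21; KP for `n` follows from KP for `2n`). [folklore] -/
theorem norm_newTerm_le_of_twoPointKP {W : Set (ℕ → ℝ)} {act : ℕ → ℝ → Bg → Pot → G.P → ℂ} {𝒜 : ℕ → Set Pot}
    {n : ℕ → ℝ → Bg → G.P → ℝ} {lip : ℕ → ℝ} {a d : G.P → ℝ} {δ : C.Dom → ℝ} {B₀ : ℕ → ℝ} {κ : ℝ}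
    (hK : TwoPointKP G W act 𝒜 n lip a d) (hdec : G.DecayExtract δ d) (hpin : G.PinBudget a δ B₀ κ)
    {g : ℕ → ℝ} (hg : g ∈ W) {k : ℕ} {U : Bg} {X : C.Dom} (hX : C.scale X = k + 1) {Q : Pot} (hQ : Q ∈ 𝒜 k) :
    ‖G.newTerm act k (g k) U X Q‖ ≤ B₀ k * Real.exp (-(κ * C.d X)) := by
  obtain ⟨ha, hd, -, hP⟩ := hK
  obtain ⟨hbd, -, hkp⟩ := hP g hg k U X hX
  have hkp1 : ∀ γ ∈ G.vol X, ∑ γ' ∈ G.vol X with G.inc γ' γ, n k (g k) U γ' * Real.exp (a γ' + d γ') ≤ a γ := by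
    intro γ hγ
    refine le_trans (Finset.sum_le_sum fun γ' hγ' => ?_) (hkp γ hγ)
    have hn : 0 ≤ n k (g k) U γ' := (norm_nonneg _).trans (hbd Q hQ γ' (Finset.mem_filter.1 hγ').1)
    nlinarith [Real.exp_pos (a γ' + d γ')]
  exact (norm_clusterSum_le_of_kp ha hd (kpd_of_norm_le (fun γ hγ => hbd Q hQ γ hγ) hkp1) (G.pin_mem X)
    (G.clus_sub X) (G.clus_pin X) (hdec X)).trans (hpin k X hX)

/-- **`OutputLipschitz` FROM TWO-POINT KP — NO RADIUS (the theorem of this leaf).**  Data: a reading `ρ k` of output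
configurations into `Pot` dominated by the weighted majorant (`‖ρ k P − ρ k P′‖ ≤ M` whenever `∀ y, |P y − P′ y| ≤ wt k y·M`);
the potential-dependent part of the new term IS the cluster sum read at `ρ k P`; every OCCURRING configuration
`ρ k (T k g′ (E g))`, g, g′ ∈ W — the hybrid ones included — is ADMISSIBLE (`∈ 𝒜 k`; printed TYPE: the history-uniform size
bounds (1.36) p. 9 of [II], a box).  Then TWO-POINT KP ∧ DECAY ∧ PIN BUDGET ⇒
`OutputLipschitz E W T Ψ κ wt (fun k => 4·lip k·B₀ k)` — the sibling leaf's `4·B₀ k/(R₀ − s₀)` with the inverse margin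
replaced by the Lipschitz scale. [cite: Balaban1988RG2Cluster, (1.36) p.9 and (2.40)-(2.41) p.21] -/
theorem outputLipschitz_of_twoPointKP {ι : Type} {E : Functional C Bg} {W : Set (ℕ → ℝ)}
    {T : ℕ → (ℕ → ℝ) → (Bg → C.Dom → ℝ) → ι → ℝ} {Ψ : ℕ → ℝ → (ι → ℝ) → Bg → C.Dom → ℝ}
    {act : ℕ → ℝ → Bg → Pot → G.P → ℂ} {𝒜 : ℕ → Set Pot} {n : ℕ → ℝ → Bg → G.P → ℝ} {lip : ℕ → ℝ}
    {a d : G.P → ℝ} {δ : C.Dom → ℝ} {B₀ : ℕ → ℝ} {κ : ℝ} {wt : ℕ → ι → ℝ} (ρ : ℕ → (ι → ℝ) → Pot)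
    (hK : TwoPointKP G W act 𝒜 n lip a d) (hdec : G.DecayExtract δ d) (hpin : G.PinBudget a δ B₀ κ)
    (hρ : ∀ (k : ℕ) (P P' : ι → ℝ) (M : ℝ), (∀ y, |P y - P' y| ≤ wt k y * M) → ‖ρ k P - ρ k P'‖ ≤ M)
    (hΨ : ∀ (k : ℕ) (s : ℝ) (P P' : ι → ℝ) (U : Bg) (X : C.Dom),
      Ψ k s P U X - Ψ k s P' U X = (G.newTerm act k s U X (ρ k P) - G.newTerm act k s U X (ρ k P')).re)
    (hocc : ∀ g ∈ W, ∀ g' ∈ W, ∀ k : ℕ, ρ k (T k g' (E g)) ∈ 𝒜 k) :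
    OutputLipschitz E W T Ψ κ wt (fun k => 4 * lip k * B₀ k) := by
  intro g hg g' hg' k M hM U X hX
  have hQQ' : ‖ρ k (T k g' (E g)) - ρ k (T k g' (E g'))‖ ≤ M := hρ k _ _ M hM
  have hM0 : 0 ≤ M := (norm_nonneg _).trans hQQ'
  have key := norm_newTerm_sub_le_of_twoPointKP G hK hdec hg' hX (U := U) (hocc g hg g' hg' k) (hocc g' hg' g' hg' k)
  have ha0 : 0 ≤ a (G.pin X) := hK.1 _
  have hlip0 : 0 ≤ lip k := hK.2.2.1 k
  have henv := hpin k X hX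
  have hB0 : 0 ≤ B₀ k * Real.exp (-(κ * C.d X)) := le_trans (mul_nonneg ha0 (Real.exp_nonneg _)) henv
  rw [hΨ]
  calc |(G.newTerm act k (g' k) U X (ρ k (T k g' (E g))) - G.newTerm act k (g' k) U X (ρ k (T k g' (E g')))).re|
      ≤ ‖G.newTerm act k (g' k) U X (ρ k (T k g' (E g))) - G.newTerm act k (g' k) U X (ρ k (T k g' (E g')))‖ :=
        Complex.abs_re_le_norm _
    _ ≤ 4 * (lip k * ‖ρ k (T k g' (E g)) - ρ k (T k g' (E g'))‖) * a (G.pin X) * Real.exp (-(δ X)) := key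
    _ = 4 * lip k * ‖ρ k (T k g' (E g)) - ρ k (T k g' (E g'))‖ * (a (G.pin X) * Real.exp (-(δ X))) := by ring
    _ ≤ 4 * lip k * M * (B₀ k * Real.exp (-(κ * C.d X))) :=
        mul_le_mul (mul_le_mul_of_nonneg_left hQQ' (by positivity)) henv (mul_nonneg ha0 (Real.exp_nonneg _))
          (by positivity)
    _ = Real.exp (-(κ * C.d X)) * (4 * lip k * B₀ k * M) := by ring

/-- `OuterLipschitz E W T κ wt lam (fun k => 4·lip k·B₀ k)` from `Factorises`, `LastCouplingLipschitz` and the hypotheses of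
`outputLipschitz_of_twoPointKP` (`T4HistoryLipschitzOuter.outerLipschitz_of_factorisation`). [folklore] -/
theorem outerLipschitz_of_twoPointKP {ι : Type} {E : Functional C Bg} {W : Set (ℕ → ℝ)}
    {T : ℕ → (ℕ → ℝ) → (Bg → C.Dom → ℝ) → ι → ℝ} {Ψ : ℕ → ℝ → (ι → ℝ) → Bg → C.Dom → ℝ}
    {act : ℕ → ℝ → Bg → Pot → G.P → ℂ} {𝒜 : ℕ → Set Pot} {n : ℕ → ℝ → Bg → G.P → ℝ} {lip : ℕ → ℝ} {a d : G.P → ℝ}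
    {δ : C.Dom → ℝ} {B₀ lam : ℕ → ℝ} {κ : ℝ} {wt : ℕ → ι → ℝ} (ρ : ℕ → (ι → ℝ) → Pot) (hfac : Factorises E W T Ψ)
    (hlast : LastCouplingLipschitz E W T Ψ κ lam) (hK : TwoPointKP G W act 𝒜 n lip a d) (hdec : G.DecayExtract δ d)
    (hpin : G.PinBudget a δ B₀ κ)
    (hρ : ∀ (k : ℕ) (P P' : ι → ℝ) (M : ℝ), (∀ y, |P y - P' y| ≤ wt k y * M) → ‖ρ k P - ρ k P'‖ ≤ M)
    (hΨ : ∀ (k : ℕ) (s : ℝ) (P P' : ι → ℝ) (U : Bg) (X : C.Dom),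
      Ψ k s P U X - Ψ k s P' U X = (G.newTerm act k s U X (ρ k P) - G.newTerm act k s U X (ρ k P')).re)
    (hocc : ∀ g ∈ W, ∀ g' ∈ W, ∀ k : ℕ, ρ k (T k g' (E g)) ∈ 𝒜 k) :
    OuterLipschitz E W T κ wt lam (fun k => 4 * lip k * B₀ k) :=
  outerLipschitz_of_factorisation hfac hlast (outputLipschitz_of_twoPointKP G ρ hK hdec hpin hρ hΨ hocc)

/-- **NE9 ∧ FADING MEMORY FROM TWO-POINT KP, every conditional by name, NO RADIUS** (`T4HistoryLipschitzRecursion`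
§8 per-creation-step sign-guarded channel binders, `c̄ = 4·lipbar·B`): `ScaleZeroFree` ∧ `AdmissibleTerms` ∧ `AdmRestrict` ∧
`ChannelAdditive` ∧ `ChannelStepSum` ∧ `ChannelSizeAtStepNN … wt τ` (τ k j ≤ τ̄ω^{k−j}) ∧ `Factorises` ∧ `LastCouplingLipschitz …
lam` (lam ≤ ℓ) ∧ TWO-POINT KP (Lipschitz scales `lip k ≤ lipbar`) ∧ DECAY ∧ PIN BUDGET (constant `B`) ∧ reading / cluster-sum
/ admissibility hypotheses ⇒ `NE9 E W κ Λ` with `Λ k i = ℓ·(ω + 4·lipbar·B·τ̄)^{k−1−i}` and `FadingMemory (ℓ/(ω + 4·lipbar·B·τ̄))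
(ω + 4·lipbar·B·τ̄) Λ`; the memory genuinely fades iff `ω + 4·lipbar·B·τ̄ < 1` (NOT PRINTED for differences, GAPS G-ne9p2-3 in
radius-free form: the sibling's margin `R₀ − s₀` ↦ `1/lipbar`).  Rung (B)+1 bookkeeping on a fixed finite torus; nothing
about [I]–[III] asserted. [folklore] -/
theorem ne9_and_fadingMemory_of_twoPointKP_perStep {ι : Type} {E : Functional C Bg} {W : Set (ℕ → ℝ)}
    {Adm : Set (Bg → C.Dom → ℝ)} {T : ℕ → (ℕ → ℝ) → (Bg → C.Dom → ℝ) → ι → ℝ}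
    {Ψ : ℕ → ℝ → (ι → ℝ) → Bg → C.Dom → ℝ} {act : ℕ → ℝ → Bg → Pot → G.P → ℂ} {𝒜 : ℕ → Set Pot}
    {n : ℕ → ℝ → Bg → G.P → ℝ} {lip : ℕ → ℝ} {a d : G.P → ℝ} {δ : C.Dom → ℝ} {κ B lipbar ℓ τbar ω : ℝ}
    {wt : ℕ → ι → ℝ} {τ : ℕ → ℕ → ℝ} {lam : ℕ → ℝ} (ρ : ℕ → (ι → ℝ) → Pot) (h0 : ScaleZeroFree E W)
    (hAdm : AdmissibleTerms E W Adm) (hres : AdmRestrict Adm) (hadd : ChannelAdditive Adm T)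
    (hsum : ChannelStepSum Adm T) (hstep : ChannelSizeAtStepNN Adm T κ wt τ) (hfac : Factorises E W T Ψ)
    (hlast : LastCouplingLipschitz E W T Ψ κ lam) (hK : TwoPointKP G W act 𝒜 n lip a d) (hdec : G.DecayExtract δ d)
    (hpin : G.PinBudget a δ (fun _ => B) κ)
    (hρ : ∀ (k : ℕ) (P P' : ι → ℝ) (M : ℝ), (∀ y, |P y - P' y| ≤ wt k y * M) → ‖ρ k P - ρ k P'‖ ≤ M)
    (hΨ : ∀ (k : ℕ) (s : ℝ) (P P' : ι → ℝ) (U : Bg) (X : C.Dom),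
      Ψ k s P U X - Ψ k s P' U X = (G.newTerm act k s U X (ρ k P) - G.newTerm act k s U X (ρ k P')).re)
    (hocc : ∀ g ∈ W, ∀ g' ∈ W, ∀ k : ℕ, ρ k (T k g' (E g)) ∈ 𝒜 k) (hℓ : 0 ≤ ℓ) (hB : 0 ≤ B)
    (hlipb : ∀ k, lip k ≤ lipbar) (hτbar : 0 ≤ τbar) (hω : 0 ≤ ω) (hpos : 0 < ω + 4 * lipbar * B * τbar)
    (hlam : ∀ k, lam k ≤ ℓ) (hτ : ∀ k j, j ≤ k → 0 ≤ τ k j ∧ τ k j ≤ τbar * ω ^ (k - j)) :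
    NE9 E W κ (prodModuli ℓ fun _ => ω + 4 * lipbar * B * τbar) ∧
      FadingMemory (ℓ / (ω + 4 * lipbar * B * τbar)) (ω + 4 * lipbar * B * τbar)
        (prodModuli ℓ fun _ => ω + 4 * lipbar * B * τbar) :=
  have hlip0 : ∀ k, 0 ≤ lip k := hK.2.2.1
  have hc : 0 ≤ 4 * lipbar * B := mul_nonneg (mul_nonneg (by norm_num) ((hlip0 0).trans (hlipb 0))) hB
  ne9_and_fadingMemory_of_perStepNN h0 hAdm hres hadd hsum hstep
    (outerLipschitz_of_twoPointKP G ρ hfac hlast hK hdec hpin hρ hΨ hocc) hℓ hc hτbar hω hpos hlam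
    (fun k => ⟨mul_nonneg (mul_nonneg (by norm_num) (hlip0 k)) hB,
      mul_le_mul_of_nonneg_right (mul_le_mul_of_nonneg_left (hlipb k) (by norm_num)) hB⟩) hτ

/-- The rate of §3 fades iff `4·lipbar·B·τ̄ < 1 − ω` — the radius-free form of the fading condition (compare
`T4HistoryLipschitzOuter.fade_of_radius`: `4Bτ̄ < (R₀ − s₀)(1 − ω)`; here `1/lipbar` plays the margin). [folklore] -/
theorem fade_iff {ω lipbar B τbar : ℝ} : ω + 4 * lipbar * B * τbar < 1 ↔ 4 * lipbar * B * τbar < 1 - ω := by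
  constructor <;> intro h <;> linarith

end Geometry

/-! ## §4 TWO-POINT KP for averaged exp-linear activities from the segment bound (kernel) -/

section Averaged

variable {C : Carriers} (G : ClusterGeom C) {Bg : Type} {Pot : Type*} [NormedAddCommGroup Pot] [NormedSpace ℂ Pot]
variable {Ω : Type*} [MeasurableSpace Ω]

/-- **THE SEGMENT MAJORANT** of averaged exp-linear activities under pointwise norm bounds `l` of the functionals, exponent
bounds `e` on the admissible set and the Lipschitz scale `lip k`: `∫ ‖pre‖·e^{e} dμ + (lip k)⁻¹·∫ ‖pre‖·l·e^{e} dμ` — the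
first summand is the TYPE of (2.15)/(2.26) (with (2.20) inside the Gaussian integral (2.23)), the second carries the Lipschitz
factor of §1 measured in units of `lip k`; when `l ≤ lip k` the whole is at most twice the first (`segMajorant_le_two_mul`).
[cite: Balaban1988RG2Cluster, (2.15) p.15, (2.18)-(2.20) p.16, (2.23)-(2.26) p.17] -/
def segMajorant {P : Type*} (μ : ℕ → ℝ → Bg → P → Measure Ω) (pre : ℕ → ℝ → Bg → P → Ω → ℂ)
    (l e : ℕ → ℝ → Bg → P → Ω → ℝ) (lip : ℕ → ℝ) : ℕ → ℝ → Bg → P → ℝ :=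
  fun k s U γ => (∫ ω, ‖pre k s U γ ω‖ * Real.exp (e k s U γ ω) ∂(μ k s U γ)) +
    (lip k)⁻¹ * ∫ ω, ‖pre k s U γ ω‖ * l k s U γ ω * Real.exp (e k s U γ ω) ∂(μ k s U γ)

/-- the segment majorant is nonnegative when the norm bounds and the scale are. [folklore] -/
theorem segMajorant_nonneg {P : Type*} (μ : ℕ → ℝ → Bg → P → Measure Ω) (pre : ℕ → ℝ → Bg → P → Ω → ℂ)
    {l : ℕ → ℝ → Bg → P → Ω → ℝ} (e : ℕ → ℝ → Bg → P → Ω → ℝ) {lip : ℕ → ℝ} (hl : ∀ k s U γ ω, 0 ≤ l k s U γ ω)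
    (hlip : ∀ k, 0 ≤ lip k) (k : ℕ) (s : ℝ) (U : Bg) (γ : P) : 0 ≤ segMajorant μ pre l e lip k s U γ :=
  add_nonneg (integral_nonneg fun _ => mul_nonneg (norm_nonneg _) (Real.exp_pos _).le)
    (mul_nonneg (inv_nonneg.2 (hlip k))
      (integral_nonneg fun ω => mul_nonneg (mul_nonneg (norm_nonneg _) (hl k s U γ ω)) (Real.exp_pos _).le))

/-- When the norm bounds of the functionals are at most the scale, `l ≤ lip k` (and `‖pre‖e^{e}` is integrable), the segment
majorant is at most TWICE the (2.26)-type majorant `∫ ‖pre‖e^{e} dμ`: the KP clause for `2·segMajorant` is then a KP condition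
on `4·∫ ‖pre‖e^{e} dμ` alone. [folklore] -/
theorem segMajorant_le_two_mul {P : Type*} {μ : ℕ → ℝ → Bg → P → Measure Ω} {pre : ℕ → ℝ → Bg → P → Ω → ℂ}
    {l e : ℕ → ℝ → Bg → P → Ω → ℝ} {lip : ℕ → ℝ} {k : ℕ} {s : ℝ} {U : Bg} {γ : P} (hlip : 0 < lip k)
    (hl0 : ∀ ω, 0 ≤ l k s U γ ω) (hl : ∀ ω, l k s U γ ω ≤ lip k)
    (hint₀ : Integrable (fun ω => ‖pre k s U γ ω‖ * Real.exp (e k s U γ ω)) (μ k s U γ)) :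
    segMajorant μ pre l e lip k s U γ ≤ 2 * ∫ ω, ‖pre k s U γ ω‖ * Real.exp (e k s U γ ω) ∂(μ k s U γ) := by
  have hmono : ∫ ω, ‖pre k s U γ ω‖ * l k s U γ ω * Real.exp (e k s U γ ω) ∂(μ k s U γ) ≤
      ∫ ω, lip k * (‖pre k s U γ ω‖ * Real.exp (e k s U γ ω)) ∂(μ k s U γ) := by
    refine integral_mono_of_nonneg (Filter.Eventually.of_forall fun ω => ?_) (hint₀.const_mul _)
      (Filter.Eventually.of_forall fun ω => ?_)
    · exact mul_nonneg (mul_nonneg (norm_nonneg _) (hl0 ω)) (Real.exp_pos _).le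
    · show ‖pre k s U γ ω‖ * l k s U γ ω * Real.exp (e k s U γ ω) ≤ lip k * (‖pre k s U γ ω‖ * Real.exp (e k s U γ ω))
      have h1 : 0 ≤ ‖pre k s U γ ω‖ * Real.exp (e k s U γ ω) := mul_nonneg (norm_nonneg _) (Real.exp_pos _).le
      nlinarith [hl ω]
  rw [integral_const_mul] at hmono
  unfold segMajorant
  have h2 : (lip k)⁻¹ * ∫ ω, ‖pre k s U γ ω‖ * l k s U γ ω * Real.exp (e k s U γ ω) ∂(μ k s U γ) ≤
      ∫ ω, ‖pre k s U γ ω‖ * Real.exp (e k s U γ ω) ∂(μ k s U γ) := by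
    rw [inv_mul_le_iff₀ hlip]
    exact hmono
  linarith

/-- **TWO-POINT KP FOR AVERAGED EXP-LINEAR ACTIVITIES (kernel).**  The activities `Q ↦ ∫ pre(ω)·exp(ℓ_ω Q) dμ(ω)` of
`T4HistoryLipschitzActivity` §7 satisfy TWO-POINT KP on the admissible sets `𝒜 k` with the segment majorant and the scales
`lip k > 0`, GIVEN: a.e.-strongly measurable prefactors, scalarly measurable functionals with pointwise norm bounds
`‖ℓ_ω‖ ≤ l(ω)` (TYPE: the radii (2.18) summed with the table weights), the exponent bound `Re ℓ_ω(Q) ≤ e(ω)` for admissible `Q`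
(TYPE: (2.20)), the integrability of `‖pre‖e^{e}` and `‖pre‖·l·e^{e}` (TYPE: the Gaussian integral (2.23)–(2.25) under the
smallness of α₅), and the DISPLAYED KP inequality for `2·segMajorant` (NOT PRINTED uniformly over the admissible set: GAPS
G-ne9p2-5 (i′)).  No ball, no holomorphy. [cite: Balaban1988RG2Cluster, (2.14)-(2.15) p.15, (2.18)-(2.20) p.16, (2.23)-(2.26) p.17; KoteckyPreiss1986, (1)-(3)] -/
theorem twoPointKP_of_avgExpLinear {W : Set (ℕ → ℝ)} {μ : ℕ → ℝ → Bg → G.P → Measure Ω}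
    {pre : ℕ → ℝ → Bg → G.P → Ω → ℂ} {lin : ℕ → ℝ → Bg → G.P → Ω → (Pot →L[ℂ] ℂ)}
    {l e : ℕ → ℝ → Bg → G.P → Ω → ℝ} {lip : ℕ → ℝ} {𝒜 : ℕ → Set Pot} {a d : G.P → ℝ} (ha : ∀ γ, 0 ≤ a γ)
    (hd : ∀ γ, 0 ≤ d γ) (hlip : ∀ k, 0 < lip k) (hpre : ∀ k s U γ, AEStronglyMeasurable (pre k s U γ) (μ k s U γ))
    (hlinw : ∀ k s U γ (Q : Pot), AEStronglyMeasurable (fun ω => lin k s U γ ω Q) (μ k s U γ))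
    (hl : ∀ k s U γ ω, ‖lin k s U γ ω‖ ≤ l k s U γ ω)
    (he : ∀ k s U γ, ∀ Q ∈ 𝒜 k, ∀ ω, (lin k s U γ ω Q).re ≤ e k s U γ ω)
    (hint₀ : ∀ k s U γ, Integrable (fun ω => ‖pre k s U γ ω‖ * Real.exp (e k s U γ ω)) (μ k s U γ))
    (hint₁ : ∀ k s U γ, Integrable (fun ω => ‖pre k s U γ ω‖ * l k s U γ ω * Real.exp (e k s U γ ω)) (μ k s U γ))
    (hkp : ∀ g ∈ W, ∀ (k : ℕ) (U : Bg) (X : C.Dom), C.scale X = k + 1 → ∀ γ ∈ G.vol X,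
      ∑ γ' ∈ G.vol X with G.inc γ' γ, 2 * segMajorant μ pre l e lip k (g k) U γ' * Real.exp (a γ' + d γ') ≤ a γ) :
    TwoPointKP G W (G.avgExpLinearAct μ pre lin) 𝒜 (segMajorant μ pre l e lip) lip a d := by
  have hl0 : ∀ k s U γ ω, 0 ≤ l k s U γ ω := fun k s U γ ω => (norm_nonneg _).trans (hl k s U γ ω)
  refine ⟨ha, hd, fun k => (hlip k).le, fun g hg k U X hX => ⟨?_, ?_, hkp g hg k U X hX⟩⟩
  · intro Q hQ γ _
    calc ‖G.avgExpLinearAct μ pre lin k (g k) U Q γ‖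
        ≤ ∫ ω, ‖pre k (g k) U γ ω‖ * Real.exp (e k (g k) U γ ω) ∂(μ k (g k) U γ) :=
          norm_integral_const_mul_cexp_le_of_re_le (hint₀ k (g k) U γ) (he k (g k) U γ Q hQ)
      _ ≤ segMajorant μ pre l e lip k (g k) U γ :=
          le_add_of_nonneg_right (mul_nonneg (inv_nonneg.2 (hlip k).le) (integral_nonneg fun ω =>
            mul_nonneg (mul_nonneg (norm_nonneg _) (hl0 k (g k) U γ ω)) (Real.exp_pos _).le))
  · intro Q hQ Q' hQ' γ _
    have hm₀ : 0 ≤ ∫ ω, ‖pre k (g k) U γ ω‖ * Real.exp (e k (g k) U γ ω) ∂(μ k (g k) U γ) :=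
      integral_nonneg fun _ => mul_nonneg (norm_nonneg _) (Real.exp_pos _).le
    calc ‖G.avgExpLinearAct μ pre lin k (g k) U Q γ - G.avgExpLinearAct μ pre lin k (g k) U Q' γ‖
        ≤ (∫ ω, ‖pre k (g k) U γ ω‖ * l k (g k) U γ ω * Real.exp (e k (g k) U γ ω) ∂(μ k (g k) U γ)) * ‖Q - Q'‖ :=
          norm_integral_const_mul_cexp_sub_le (hpre k (g k) U γ) (hlinw k (g k) U γ) (hl k (g k) U γ)
            (hint₀ k (g k) U γ) (hint₁ k (g k) U γ) (he k (g k) U γ Q hQ) (he k (g k) U γ Q' hQ')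
      _ = lip k * ‖Q - Q'‖ *
            ((lip k)⁻¹ * ∫ ω, ‖pre k (g k) U γ ω‖ * l k (g k) U γ ω * Real.exp (e k (g k) U γ ω) ∂(μ k (g k) U γ)) := by
          rw [← mul_assoc, mul_right_comm (lip k), mul_inv_cancel₀ (hlip k).ne', one_mul, mul_comm]
      _ ≤ lip k * ‖Q - Q'‖ * segMajorant μ pre l e lip k (g k) U γ :=
          mul_le_mul_of_nonneg_left (le_add_of_nonneg_left hm₀) (mul_nonneg (hlip k).le (norm_nonneg _))

end Averaged

/-! ## §5 With a support map: the KP clause for `2·segMajorant` from DECAY (∘ `Supported.kpClause_of_decay`) -/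

section Decay

variable {C : Carriers} {G : ClusterGeom C} {Bg : Type} {α : Type*} [DecidableEq α] {adj : α → α → Prop}
  [DecidableRel adj] [Std.Symm adj] {D : ℕ}
variable {Pot : Type*} [NormedAddCommGroup Pot] [NormedSpace ℂ Pot] {Ω : Type*} [MeasurableSpace Ω]

/-- **TWO-POINT KP FROM DECAY OF THE SEGMENT MAJORANT (kernel).**  Under a support map, if the segment majorant DECAYS in
the support size at the occurring couplings, `segMajorant ≤ ε k·y^{|supp γ'|}` on every step volume, and
`y·e^{a₁+d₁}·e^{Dθ} ≤ θ`, `2ε k·θ·(D + 1) ≤ a₁`, `0 ≤ a₁, d₁, ε k, y`, `0 < lip k`, then TWO-POINT KP holds with the size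
weights `a₁·|supp|`, `d₁·|supp|`.  DISPLAYED: the decay bound — print proves a bound of this TYPE for ONE table ((2.26)
p. 17 → Lemma 3 (2.38) p. 20 with `C₃ ∝ E₀`); its uniformity over the admissible box is GAPS G-ne9p2-5 (i′). [cite: Balaban1988RG2Cluster, (2.26) p.17, (2.37)-(2.41) pp.20-21; KoteckyPreiss1986, (1)-(3)] -/
theorem twoPointKP_of_avgExpLinear_decay (S : Supported G α adj D) {W : Set (ℕ → ℝ)}
    {μ : ℕ → ℝ → Bg → G.P → Measure Ω} {pre : ℕ → ℝ → Bg → G.P → Ω → ℂ}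
    {lin : ℕ → ℝ → Bg → G.P → Ω → (Pot →L[ℂ] ℂ)} {l e : ℕ → ℝ → Bg → G.P → Ω → ℝ} {lip : ℕ → ℝ} {𝒜 : ℕ → Set Pot}
    {ε : ℕ → ℝ} {y a₁ d₁ θ : ℝ} (ha₁ : 0 ≤ a₁) (hd₁ : 0 ≤ d₁) (hlip : ∀ k, 0 < lip k)
    (hpre : ∀ k s U γ, AEStronglyMeasurable (pre k s U γ) (μ k s U γ))
    (hlinw : ∀ k s U γ (Q : Pot), AEStronglyMeasurable (fun ω => lin k s U γ ω Q) (μ k s U γ))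
    (hl : ∀ k s U γ ω, ‖lin k s U γ ω‖ ≤ l k s U γ ω)
    (he : ∀ k s U γ, ∀ Q ∈ 𝒜 k, ∀ ω, (lin k s U γ ω Q).re ≤ e k s U γ ω)
    (hint₀ : ∀ k s U γ, Integrable (fun ω => ‖pre k s U γ ω‖ * Real.exp (e k s U γ ω)) (μ k s U γ))
    (hint₁ : ∀ k s U γ, Integrable (fun ω => ‖pre k s U γ ω‖ * l k s U γ ω * Real.exp (e k s U γ ω)) (μ k s U γ))
    (hε : ∀ k, 0 ≤ ε k) (hy : 0 ≤ y)
    (hdecay : ∀ g ∈ W, ∀ (k : ℕ) (U : Bg) (X : C.Dom), C.scale X = k + 1 → ∀ γ' ∈ G.vol X,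
      segMajorant μ pre l e lip k (g k) U γ' ≤ ε k * y ^ (S.supp γ').card)
    (hθ : y * Real.exp (a₁ + d₁) * Real.exp (D * θ) ≤ θ) (hεθ : ∀ k, 2 * ε k * θ * ((D : ℝ) + 1) ≤ a₁) :
    TwoPointKP G W (G.avgExpLinearAct μ pre lin) 𝒜 (segMajorant μ pre l e lip) lip (S.sizeWeight a₁)
      (S.sizeWeight d₁) := by
  have hl0 : ∀ k s U γ ω, 0 ≤ l k s U γ ω := fun k s U γ ω => (norm_nonneg _).trans (hl k s U γ ω)
  have hkp := S.kpClause_of_decay (W := W) (M := fun k s U γ => 2 * segMajorant μ pre l e lip k s U γ)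
    (ε := fun k => 2 * ε k) (fun k => by have := hε k; positivity) hy
    (fun k s U γ' => mul_nonneg (by norm_num) (segMajorant_nonneg μ pre e hl0 (fun k => (hlip k).le) k s U γ'))
    (fun g hg k U X hX γ' hγ' => by
      have h := hdecay g hg k U X hX γ' hγ'
      show 2 * segMajorant μ pre l e lip k (g k) U γ' ≤ 2 * ε k * y ^ (S.supp γ').card
      nlinarith)
    hθ hεθ
  exact twoPointKP_of_avgExpLinear G (S.sizeWeight_nonneg ha₁) (S.sizeWeight_nonneg hd₁) hlip hpre hlinw hl he hint₀
    hint₁ hkp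

end Decay

/-! ## §6 THE BOX INSTANCE: tables `Sp →ᵇ ℂ`, evaluation-type functionals, componentwise size bounds -/

section Box

open BoundedContinuousFunction

variable {Sp : Type*} [TopologicalSpace Sp] {F : Type*} [Fintype F]

/-- **BOX OF TABLES** `{T | ∀ x, ‖T x‖ ≤ β x}` — componentwise size bounds, one inequality per domain and field
configuration: the TYPE of the inductive bounds (I.1.18) = [I] (1.18) p. 263 («|𝐄^{(j)}(X, g_{j−1}, 𝐔, 𝐉)| ≦ E₀ exp(−κd_j(X))»;
(0.25) p. 257), of the table bounds of [II], Lemma 1 (1.36) p. 9 («|𝐕′_k(Y, 𝐔, 𝐉, B)| ≦ E₀ε₁C₁M^q exp C₂κ₁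
exp(−(1 − 2δ)κd_k(Y))»), and of (1.42)–(1.43); NOT a norm ball.  (DOCFIX v1.2: v1–v1.1 attributed the first display to
(1.36).) [cite: Balaban1987RG1, (0.25) p.257, (1.18) p.263; Balaban1988RG2Cluster, (1.36) p.9] -/
def boxSet (β : Sp → ℝ) : Set (Sp →ᵇ ℂ) := {T | ∀ x, ‖T x‖ ≤ β x}

/-- membership in a box. [folklore] -/
theorem mem_boxSet {β : Sp → ℝ} {T : Sp →ᵇ ℂ} : T ∈ boxSet β ↔ ∀ x, ‖T x‖ ≤ β x := Iff.rfl

/-- a norm ball is the box with constant bounds (so §6 contains the ball-type occupation hypothesis of the sibling leaf).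
[folklore] -/
theorem closedBall_subset_boxSet (R : ℝ) : closedBall (0 : Sp →ᵇ ℂ) R ⊆ boxSet (fun _ : Sp => R) :=
  fun T hT x => (T.norm_coe_le_norm x).trans (mem_closedBall_zero_iff.1 hT)

/-- **THE (2.20)-TYPE EXPONENT BOUND ON A BOX (kernel)**: for a table in the box `β`,
`Re Σ_Y c(Y)·T(pt Y) ≤ Σ_Y ‖c(Y)‖·β(pt Y)` — radii × pointwise sizes, the shape of (2.19)–(2.20) p. 16 of [II].
[cite: Balaban1988RG2Cluster, (2.19)-(2.20) p.16] -/
theorem re_evalFunctional_le_of_mem_boxSet {c : F → ℂ} {pt : F → Sp} {β : Sp → ℝ} {T : Sp →ᵇ ℂ}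
    (hT : T ∈ boxSet β) : (evalFunctional c pt T).re ≤ ∑ Y, ‖c Y‖ * β (pt Y) := by
  rw [evalFunctional_apply]
  calc (∑ Y, c Y * T (pt Y)).re ≤ ‖∑ Y, c Y * T (pt Y)‖ := (le_abs_self _).trans (Complex.abs_re_le_norm _)
    _ ≤ ∑ Y, ‖c Y * T (pt Y)‖ := norm_sum_le _ _
    _ ≤ ∑ Y, ‖c Y‖ * β (pt Y) := Finset.sum_le_sum fun Y _ => by
        rw [norm_mul]
        exact mul_le_mul_of_nonneg_left (hT (pt Y)) (norm_nonneg _)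

variable [MeasurableSpace Sp] [OpensMeasurableSpace Sp] {Ω : Type*} [MeasurableSpace Ω] {Bg : Type} {P : Type*}

/-- the pointwise norm bounds of evaluation-type functionals: `Σ_Y ‖c_ω(Y)‖` (TYPE: the radii (2.18) summed).
[cite: Balaban1988RG2Cluster, (2.18) p.16] -/
def coeffSum (c : ℕ → ℝ → Bg → P → Ω → F → ℂ) : ℕ → ℝ → Bg → P → Ω → ℝ :=
  fun k s U γ ω => ∑ Y, ‖c k s U γ ω Y‖

/-- the exponent bounds on the box `β k`: `Σ_Y ‖c_ω(Y)‖·β k (pt_ω Y)` (TYPE: (2.20)). [cite: Balaban1988RG2Cluster, (2.20) p.16] -/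
def boxExponent (c : ℕ → ℝ → Bg → P → Ω → F → ℂ) (pt : ℕ → ℝ → Bg → P → Ω → F → Sp) (β : ℕ → Sp → ℝ) :
    ℕ → ℝ → Bg → P → Ω → ℝ :=
  fun k s U γ ω => ∑ Y, ‖c k s U γ ω Y‖ * β k (pt k s U γ ω Y)

variable {C : Carriers} (G : ClusterGeom C)

/-- **TWO-POINT KP FOR AVERAGED EXP-EVALUATION ACTIVITIES ON A BOX (kernel)**: activities
`T ↦ ∫ pre(ω)·exp(Σ_Y c_ω(Y)·T(pt_ω(Y))) dμ(ω)` on the table space `Sp →ᵇ ℂ` satisfy TWO-POINT KP on the boxes `boxSet (β k)`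
with the segment majorant built from `coeffSum` and `boxExponent` and the scales `lip k > 0`, GIVEN: a.e.-strongly measurable
prefactors, measurable coefficients and evaluation points (scalar measurability and the norm / exponent bounds are then by
construction: `aestronglyMeasurable_evalFunctional_apply`, `norm_evalFunctional_le`, `re_evalFunctional_le_of_mem_boxSet`),
the two integrabilities, and the displayed KP inequality for `2·segMajorant`. [cite: Balaban1988RG2Cluster, (2.14)-(2.15) p.15, (2.18)-(2.20) p.16, (2.23)-(2.26) p.17; KoteckyPreiss1986, (1)-(3)] -/
theorem twoPointKP_of_avgEvalExpLinear_box {W : Set (ℕ → ℝ)} {μ : ℕ → ℝ → Bg → G.P → Measure Ω}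
    {pre : ℕ → ℝ → Bg → G.P → Ω → ℂ} {c : ℕ → ℝ → Bg → G.P → Ω → F → ℂ} {pt : ℕ → ℝ → Bg → G.P → Ω → F → Sp}
    {β : ℕ → Sp → ℝ} {lip : ℕ → ℝ} {a d : G.P → ℝ} (ha : ∀ γ, 0 ≤ a γ) (hd : ∀ γ, 0 ≤ d γ) (hlip : ∀ k, 0 < lip k)
    (hpre : ∀ k s U γ, AEStronglyMeasurable (pre k s U γ) (μ k s U γ))
    (hc : ∀ k s U γ Y, AEStronglyMeasurable (fun ω => c k s U γ ω Y) (μ k s U γ))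
    (hpt : ∀ k s U γ Y, Measurable fun ω => pt k s U γ ω Y)
    (hint₀ : ∀ k s U γ, Integrable (fun ω => ‖pre k s U γ ω‖ * Real.exp (boxExponent c pt β k s U γ ω)) (μ k s U γ))
    (hint₁ : ∀ k s U γ, Integrable
      (fun ω => ‖pre k s U γ ω‖ * coeffSum c k s U γ ω * Real.exp (boxExponent c pt β k s U γ ω)) (μ k s U γ))
    (hkp : ∀ g ∈ W, ∀ (k : ℕ) (U : Bg) (X : C.Dom), C.scale X = k + 1 → ∀ γ ∈ G.vol X,
      ∑ γ' ∈ G.vol X with G.inc γ' γ,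
        2 * segMajorant μ pre (coeffSum c) (boxExponent c pt β) lip k (g k) U γ' * Real.exp (a γ' + d γ') ≤ a γ) :
    TwoPointKP G W (G.avgExpLinearAct μ pre fun k s U γ ω => evalFunctional (c k s U γ ω) (pt k s U γ ω))
      (fun k => boxSet (β k)) (segMajorant μ pre (coeffSum c) (boxExponent c pt β) lip) lip a d :=
  twoPointKP_of_avgExpLinear G ha hd hlip hpre
    (fun k s U γ Q => aestronglyMeasurable_evalFunctional_apply (hc k s U γ) (hpt k s U γ) Q)
    (fun _ _ _ _ _ => norm_evalFunctional_le _ _) (fun _ _ _ _ _ hQ _ => re_evalFunctional_le_of_mem_boxSet hQ)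
    hint₀ hint₁ hkp

variable {G} {α : Type*} [DecidableEq α] {adj : α → α → Prop} [DecidableRel adj] [Std.Symm adj] {D : ℕ}

/-- **TWO-POINT KP ON A BOX FROM DECAY (kernel)**: §5 specialised to the box instance — the KP inequality from the decay of
the segment majorant `≤ ε k·y^{|supp|}` and the smallness `y·e^{a₁+d₁}·e^{Dθ} ≤ θ`, `2ε k·θ·(D + 1) ≤ a₁`.
[cite: Balaban1988RG2Cluster, (2.26) p.17, (2.37)-(2.41) pp.20-21; KoteckyPreiss1986, (1)-(3)] -/
theorem twoPointKP_of_avgEvalExpLinear_box_decay (S : Supported G α adj D) {W : Set (ℕ → ℝ)}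
    {μ : ℕ → ℝ → Bg → G.P → Measure Ω} {pre : ℕ → ℝ → Bg → G.P → Ω → ℂ} {c : ℕ → ℝ → Bg → G.P → Ω → F → ℂ}
    {pt : ℕ → ℝ → Bg → G.P → Ω → F → Sp} {β : ℕ → Sp → ℝ} {lip ε : ℕ → ℝ} {y a₁ d₁ θ : ℝ} (ha₁ : 0 ≤ a₁)
    (hd₁ : 0 ≤ d₁) (hlip : ∀ k, 0 < lip k) (hpre : ∀ k s U γ, AEStronglyMeasurable (pre k s U γ) (μ k s U γ))
    (hc : ∀ k s U γ Y, AEStronglyMeasurable (fun ω => c k s U γ ω Y) (μ k s U γ))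
    (hpt : ∀ k s U γ Y, Measurable fun ω => pt k s U γ ω Y)
    (hint₀ : ∀ k s U γ, Integrable (fun ω => ‖pre k s U γ ω‖ * Real.exp (boxExponent c pt β k s U γ ω)) (μ k s U γ))
    (hint₁ : ∀ k s U γ, Integrable
      (fun ω => ‖pre k s U γ ω‖ * coeffSum c k s U γ ω * Real.exp (boxExponent c pt β k s U γ ω)) (μ k s U γ))
    (hε : ∀ k, 0 ≤ ε k) (hy : 0 ≤ y)
    (hdecay : ∀ g ∈ W, ∀ (k : ℕ) (U : Bg) (X : C.Dom), C.scale X = k + 1 → ∀ γ' ∈ G.vol X,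
      segMajorant μ pre (coeffSum c) (boxExponent c pt β) lip k (g k) U γ' ≤ ε k * y ^ (S.supp γ').card)
    (hθ : y * Real.exp (a₁ + d₁) * Real.exp (D * θ) ≤ θ) (hεθ : ∀ k, 2 * ε k * θ * ((D : ℝ) + 1) ≤ a₁) :
    TwoPointKP G W (G.avgExpLinearAct μ pre fun k s U γ ω => evalFunctional (c k s U γ ω) (pt k s U γ ω))
      (fun k => boxSet (β k)) (segMajorant μ pre (coeffSum c) (boxExponent c pt β) lip) lip (S.sizeWeight a₁)
      (S.sizeWeight d₁) :=
  twoPointKP_of_avgExpLinear_decay S ha₁ hd₁ hlip hpre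
    (fun k s U γ Q => aestronglyMeasurable_evalFunctional_apply (hc k s U γ) (hpt k s U γ) Q)
    (fun _ _ _ _ _ => norm_evalFunctional_le _ _) (fun _ _ _ _ _ hQ _ => re_evalFunctional_le_of_mem_boxSet hQ)
    hint₀ hint₁ hε hy hdecay hθ hεθ

end Box

/-! ## §7 END-TO-END on a cube chart: NE9 ∧ FadingMemory with the BOX occupation hypothesis — no radius -/

section EndToEnd

open BoundedContinuousFunction

variable {C : Carriers} {α : Type} [DecidableEq α] {adj : α → α → Prop} [DecidableRel adj] [Std.Symm adj] {D : ℕ}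
variable {Bg : Type} {Sp : Type*} [TopologicalSpace Sp] [MeasurableSpace Sp] [OpensMeasurableSpace Sp] {F : Type*}
  [Fintype F] {Ω : Type*} [MeasurableSpace Ω]

/-- **NE9 ∧ FADING MEMORY ON A CUBE CHART, BOX FORM (kernel end-to-end; geometry constructed, no ball).**  The sibling
theorem `CubeChart.ne9_and_fadingMemory_of_decay` with: occupation hypothesis «occurring tables lie in the BOX `β k`» (TYPE
(1.36)) instead of a norm ball, NO `s₀ < R₀` / `0 ≤ R₀` — the inverse margin `1/(R₀ − s₀)` of the rate is replaced by the bound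
`lipbar` of the Lipschitz scales (TYPE: the radii (2.18) × the weights (1.36), `O(α₄)`), prefactors a.e.-strongly measurable
with the two weighted integrabilities (TYPE (2.23)–(2.25)) instead of integrable, decay of the SEGMENT majorant (GAPS G-ne9p2-5
(i′)) instead of the ball majorant, smallness `2ε k·θ·(D + 1) ≤ a₁`; moduli `ℓ·∏(ω + 4·lipbar·a₁·τ̄)`, fading iff
`ω + 4·lipbar·a₁·τ̄ < 1`.  DISPLAYED recursion-side binders unchanged and by name: `ScaleZeroFree`, `AdmissibleTerms`,
`AdmRestrict`, `ChannelAdditive`, `ChannelStepSum`, `ChannelSizeAtStepNN`, `Factorises`, `LastCouplingLipschitz` (NE9-LAST,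
wall (L)), the read-out `ρ` with its weighted-Lipschitz law. [cite: Balaban1988RG2Cluster, (1.36) p.9, (2.11)-(2.15) pp.14-15, (2.18)-(2.20) p.16, (2.23)-(2.26) p.17, (2.30) p.18, Lemma 3 (2.38) p.20; KoteckyPreiss1986, (1)-(3)] -/
theorem cubeChart_ne9_and_fadingMemory_of_box (Γ : CubeChart C α adj D) {ι : Type} {E : Functional C Bg}
    {W : Set (ℕ → ℝ)} {Adm : Set (Bg → C.Dom → ℝ)} {T : ℕ → (ℕ → ℝ) → (Bg → C.Dom → ℝ) → ι → ℝ}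
    {Ψ : ℕ → ℝ → (ι → ℝ) → Bg → C.Dom → ℝ}
    {μ : ℕ → ℝ → Bg → Finset α → Measure Ω} {pre : ℕ → ℝ → Bg → Finset α → Ω → ℂ}
    {c : ℕ → ℝ → Bg → Finset α → Ω → F → ℂ} {pt : ℕ → ℝ → Bg → Finset α → Ω → F → Sp} {β : ℕ → Sp → ℝ}
    {lip ε : ℕ → ℝ} {y a₁ d₁ θ κ lipbar ℓ τbar ω : ℝ} {wt : ℕ → ι → ℝ} {τ : ℕ → ℕ → ℝ} {lam : ℕ → ℝ}
    (ρ : ℕ → (ι → ℝ) → (Sp →ᵇ ℂ))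
    -- recursion side (displayed, named binders of the sibling leaves)
    (h0 : ScaleZeroFree E W) (hAdm : AdmissibleTerms E W Adm) (hres : AdmRestrict Adm)
    (hadd : ChannelAdditive Adm T) (hsum : ChannelStepSum Adm T) (hstep : ChannelSizeAtStepNN Adm T κ wt τ)
    (hfac : Factorises E W T Ψ) (hlast : LastCouplingLipschitz E W T Ψ κ lam)
    (hρ : ∀ (k : ℕ) (P P' : ι → ℝ) (M : ℝ), (∀ y, |P y - P' y| ≤ wt k y * M) → ‖ρ k P - ρ k P'‖ ≤ M)
    (hΨ : ∀ (k : ℕ) (s : ℝ) (P P' : ι → ℝ) (U : Bg) (X : C.Dom),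
      Ψ k s P U X - Ψ k s P' U X =
        (Γ.geom.newTerm (Γ.geom.avgExpLinearAct μ pre fun k s U γ ω => evalFunctional (c k s U γ ω) (pt k s U γ ω))
            k s U X (ρ k P) -
          Γ.geom.newTerm (Γ.geom.avgExpLinearAct μ pre fun k s U γ ω => evalFunctional (c k s U γ ω) (pt k s U γ ω))
            k s U X (ρ k P')).re)
    -- occupation: occurring tables lie in the box (TYPE (1.36)); no radius
    (hocc : ∀ g ∈ W, ∀ g' ∈ W, ∀ (k : ℕ) (x : Sp), ‖ρ k (T k g' (E g)) x‖ ≤ β k x)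
    -- activity side: regularity data (discharged types), scales, the two integrabilities, (A′) decay of the segment majorant
    (hpre : ∀ k s U γ, AEStronglyMeasurable (pre k s U γ) (μ k s U γ))
    (hc : ∀ k s U γ Y, AEStronglyMeasurable (fun ω => c k s U γ ω Y) (μ k s U γ))
    (hpt : ∀ k s U γ Y, Measurable fun ω => pt k s U γ ω Y) (hlip : ∀ k, 0 < lip k) (hlipb : ∀ k, lip k ≤ lipbar)
    (hint₀ : ∀ k s U γ, Integrable (fun ω => ‖pre k s U γ ω‖ * Real.exp (boxExponent c pt β k s U γ ω)) (μ k s U γ))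
    (hint₁ : ∀ k s U γ, Integrable
      (fun ω => ‖pre k s U γ ω‖ * coeffSum c k s U γ ω * Real.exp (boxExponent c pt β k s U γ ω)) (μ k s U γ))
    (hε : ∀ k, 0 ≤ ε k) (hy : 0 ≤ y)
    (hdecay : ∀ g ∈ W, ∀ (k : ℕ) (U : Bg) (X : C.Dom), C.scale X = k + 1 → ∀ γ' ∈ Γ.vol X,
      segMajorant μ pre (coeffSum c) (boxExponent c pt β) lip k (g k) U γ' ≤ ε k * y ^ γ'.card)
    -- (C) scalar smallness and the envelope data
    (hθ : y * Real.exp (a₁ + d₁) * Real.exp (D * θ) ≤ θ) (hεθ : ∀ k, 2 * ε k * θ * ((D : ℝ) + 1) ≤ a₁)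
    (ha₁ : 0 ≤ a₁) (hκ : 0 ≤ κ) (hκd : κ ≤ d₁) (hℓ : 0 ≤ ℓ) (hτbar : 0 ≤ τbar) (hω : 0 ≤ ω)
    (hpos : 0 < ω + 4 * lipbar * a₁ * τbar) (hlam : ∀ k, lam k ≤ ℓ)
    (hτ : ∀ k j, j ≤ k → 0 ≤ τ k j ∧ τ k j ≤ τbar * ω ^ (k - j)) :
    NE9 E W κ (prodModuli ℓ fun _ => ω + 4 * lipbar * a₁ * τbar) ∧
      FadingMemory (ℓ / (ω + 4 * lipbar * a₁ * τbar)) (ω + 4 * lipbar * a₁ * τbar)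
        (prodModuli ℓ fun _ => ω + 4 * lipbar * a₁ * τbar) := by
  have hd₁ : 0 ≤ d₁ := hκ.trans hκd
  have hKP := twoPointKP_of_avgEvalExpLinear_box_decay Γ.supported (W := W) (μ := μ) (pre := pre) (c := c) (pt := pt)
    (β := β) (ε := ε) ha₁ hd₁ hlip hpre hc hpt hint₀ hint₁ hε hy
    (fun g hg k U X hX γ' hγ' => hdecay g hg k U X hX γ' hγ') hθ hεθ
  exact ne9_and_fadingMemory_of_twoPointKP_perStep Γ.geom ρ h0 hAdm hres hadd hsum hstep hfac hlast hKP
    (Γ.decayExtract hd₁) (Γ.pinBudget ha₁ hκ hκd) hρ hΨ (fun g hg g' hg' k => fun x => hocc g hg g' hg' k x) hℓ ha₁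
    hlipb hτbar hω hpos hlam hτ

end EndToEnd

/-! ## §7b (v1.1) THE BOX MAJORANT ALONE: the segment majorant from `∫‖pre‖e^{boxExponent}dμ` and a scale bound -/

section BoxMajorant

open BoundedContinuousFunction

variable {Bg : Type} {Ω : Type*} [MeasurableSpace Ω]

/-- arithmetic: `(1 + n)·yⁿ ≤ (2y)ⁿ` for `0 ≤ y` (from `n + 1 ≤ 2ⁿ`) — a polynomial factor in the support size is
absorbed by halving the decay base. [folklore] -/
theorem one_add_mul_pow_le {y : ℝ} (hy : 0 ≤ y) (n : ℕ) : (1 + (n : ℝ)) * y ^ n ≤ (2 * y) ^ n := by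
  rw [mul_pow]
  refine mul_le_mul_of_nonneg_right ?_ (pow_nonneg hy n)
  have h : n < 2 ^ n := Nat.lt_two_pow_self
  have h' : (n : ℝ) + 1 ≤ (2 : ℝ) ^ n := by exact_mod_cast h
  linarith

/-- **THE SEGMENT MAJORANT FROM THE (2.26)-TYPE MAJORANT (kernel)**: if the norm bounds of the functionals are at most
`lip k·L` (`L` a constant of the polymer — TYPE: the radii (2.18) × the sizes (1.36) summed over the domains of `𝐃` by
(2.19), `O(α₄)·#cubes`), then `segMajorant ≤ (1 + L)·∫‖pre‖e^{e}dμ`. [cite: Balaban1988RG2Cluster, (2.18)-(2.19) p.16, (2.26) p.17] -/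
theorem segMajorant_le_one_add_mul {P : Type*} {μ : ℕ → ℝ → Bg → P → Measure Ω} {pre : ℕ → ℝ → Bg → P → Ω → ℂ}
    {l e : ℕ → ℝ → Bg → P → Ω → ℝ} {lip : ℕ → ℝ} {k : ℕ} {s : ℝ} {U : Bg} {γ : P} {L : ℝ} (hlip : 0 < lip k)
    (hl0 : ∀ ω, 0 ≤ l k s U γ ω) (hl : ∀ ω, l k s U γ ω ≤ lip k * L)
    (hint₀ : Integrable (fun ω => ‖pre k s U γ ω‖ * Real.exp (e k s U γ ω)) (μ k s U γ)) :
    segMajorant μ pre l e lip k s U γ ≤ (1 + L) * ∫ ω, ‖pre k s U γ ω‖ * Real.exp (e k s U γ ω) ∂(μ k s U γ) := by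
  have hmono : ∫ ω, ‖pre k s U γ ω‖ * l k s U γ ω * Real.exp (e k s U γ ω) ∂(μ k s U γ) ≤
      ∫ ω, (lip k * L) * (‖pre k s U γ ω‖ * Real.exp (e k s U γ ω)) ∂(μ k s U γ) := by
    refine integral_mono_of_nonneg (Filter.Eventually.of_forall fun ω => ?_) (hint₀.const_mul _)
      (Filter.Eventually.of_forall fun ω => ?_)
    · exact mul_nonneg (mul_nonneg (norm_nonneg _) (hl0 ω)) (Real.exp_pos _).le
    · show ‖pre k s U γ ω‖ * l k s U γ ω * Real.exp (e k s U γ ω) ≤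
        lip k * L * (‖pre k s U γ ω‖ * Real.exp (e k s U γ ω))
      have h1 : 0 ≤ ‖pre k s U γ ω‖ * Real.exp (e k s U γ ω) := mul_nonneg (norm_nonneg _) (Real.exp_pos _).le
      nlinarith [hl ω]
  rw [integral_const_mul] at hmono
  unfold segMajorant
  have h2 : (lip k)⁻¹ * ∫ ω, ‖pre k s U γ ω‖ * l k s U γ ω * Real.exp (e k s U γ ω) ∂(μ k s U γ) ≤
      L * ∫ ω, ‖pre k s U γ ω‖ * Real.exp (e k s U γ ω) ∂(μ k s U γ) := by
    rw [inv_mul_le_iff₀ hlip, ← mul_assoc]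
    exact hmono
  linarith

/-- the `l`-weighted integrability from the unweighted one under a uniform bound `0 ≤ l ≤ M` and a.e.-strong
measurability of `l` (so the second integrability of §4/§6 is not an independent hypothesis when the norm bounds of the
functionals are bounded on the polymer). [folklore] -/
theorem integrable_weighted_of_le {P : Type*} {μ : ℕ → ℝ → Bg → P → Measure Ω} {pre : ℕ → ℝ → Bg → P → Ω → ℂ}
    {l e : ℕ → ℝ → Bg → P → Ω → ℝ} {k : ℕ} {s : ℝ} {U : Bg} {γ : P} {M : ℝ}
    (hlm : AEStronglyMeasurable (l k s U γ) (μ k s U γ)) (hl0 : ∀ ω, 0 ≤ l k s U γ ω) (hl : ∀ ω, l k s U γ ω ≤ M)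
    (hint₀ : Integrable (fun ω => ‖pre k s U γ ω‖ * Real.exp (e k s U γ ω)) (μ k s U γ)) :
    Integrable (fun ω => ‖pre k s U γ ω‖ * l k s U γ ω * Real.exp (e k s U γ ω)) (μ k s U γ) := by
  have heq : (fun ω => ‖pre k s U γ ω‖ * l k s U γ ω * Real.exp (e k s U γ ω)) =
      fun ω => (‖pre k s U γ ω‖ * Real.exp (e k s U γ ω)) * l k s U γ ω := by
    funext ω; ring
  rw [heq]
  refine (hint₀.const_mul M).mono' (hint₀.aestronglyMeasurable.mul hlm) (Filter.Eventually.of_forall fun ω => ?_)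
  have h1 : 0 ≤ ‖pre k s U γ ω‖ * Real.exp (e k s U γ ω) := mul_nonneg (norm_nonneg _) (Real.exp_pos _).le
  rw [Real.norm_of_nonneg (mul_nonneg h1 (hl0 ω))]
  calc ‖pre k s U γ ω‖ * Real.exp (e k s U γ ω) * l k s U γ ω ≤ ‖pre k s U γ ω‖ * Real.exp (e k s U γ ω) * M :=
        mul_le_mul_of_nonneg_left (hl ω) h1
    _ = M * (‖pre k s U γ ω‖ * Real.exp (e k s U γ ω)) := by ring

variable {Sp : Type*} [TopologicalSpace Sp] [MeasurableSpace Sp] [OpensMeasurableSpace Sp] {F : Type*} [Fintype F]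
  {P : Type*}

omit [MeasurableSpace Ω] in
/-- the coefficient sums are nonnegative. [folklore] -/
theorem coeffSum_nonneg (c : ℕ → ℝ → Bg → P → Ω → F → ℂ) (k : ℕ) (s : ℝ) (U : Bg) (γ : P) (ω : Ω) :
    0 ≤ coeffSum c k s U γ ω :=
  Finset.sum_nonneg fun _ _ => norm_nonneg _

/-- the coefficient sums are a.e.-strongly measurable when the coefficients are. [folklore] -/
theorem aestronglyMeasurable_coeffSum {μ : ℕ → ℝ → Bg → P → Measure Ω} {c : ℕ → ℝ → Bg → P → Ω → F → ℂ}
    (hc : ∀ k s U γ Y, AEStronglyMeasurable (fun ω => c k s U γ ω Y) (μ k s U γ)) (k : ℕ) (s : ℝ) (U : Bg) (γ : P) :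
    AEStronglyMeasurable (coeffSum c k s U γ) (μ k s U γ) :=
  Finset.aestronglyMeasurable_fun_sum _ fun Y _ => (hc k s U γ Y).norm

end BoxMajorant

section EndToEndBoxMajorant

open BoundedContinuousFunction

variable {C : Carriers} {α : Type} [DecidableEq α] {adj : α → α → Prop} [DecidableRel adj] [Std.Symm adj] {D : ℕ}
variable {Bg : Type} {Sp : Type*} [TopologicalSpace Sp] [MeasurableSpace Sp] [OpensMeasurableSpace Sp] {F : Type*}
  [Fintype F] {Ω : Type*} [MeasurableSpace Ω]

/-- **NE9 ∧ FADING MEMORY ON A CUBE CHART FROM THE BOX MAJORANT ALONE (kernel end-to-end, v1.1).**  §7 with the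
activity side reduced further: instead of the decay of the segment majorant and the second integrability, display (L′) a
scale bound on the coefficient sums, `Σ_Y ‖c_ω(Y)‖ ≤ lip k·#cubes(γ)` (TYPE: radii (2.18) × sizes (1.36), summed over the
domains of `𝐃 ⊆ 𝐃_k` inside the polymer by (2.19) p. 16), and (A″) the decay of the BOX MAJORANT
`∫‖pre‖e^{boxExponent}dμ ≤ ε k·y^{#cubes}` — the (2.26)-TYPE majorant of print ((2.15) → (2.20) → (2.23) → (2.26) p. 15–17,
then Lemma 3 (2.38) p. 20), which print proves for the ONE table `𝐕_k`; its validity for every table of the box (1.36) is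
GAPS G-ne9p2-5 (i″), displayed.  The polynomial factor `1 + #cubes` is absorbed by `y ↦ 2y` in the smallness (C).  Nothing of
[I]–[III] asserted; rung (B)+1 bookkeeping. [cite: Balaban1988RG2Cluster, (1.36) p.9, (2.15) p.15, (2.18)-(2.20) p.16, (2.23)-(2.26) p.17, Lemma 3 (2.38) p.20; KoteckyPreiss1986, (1)-(3)] -/
theorem cubeChart_ne9_and_fadingMemory_of_boxMajorant (Γ : CubeChart C α adj D) {ι : Type} {E : Functional C Bg}
    {W : Set (ℕ → ℝ)} {Adm : Set (Bg → C.Dom → ℝ)} {T : ℕ → (ℕ → ℝ) → (Bg → C.Dom → ℝ) → ι → ℝ}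
    {Ψ : ℕ → ℝ → (ι → ℝ) → Bg → C.Dom → ℝ}
    {μ : ℕ → ℝ → Bg → Finset α → Measure Ω} {pre : ℕ → ℝ → Bg → Finset α → Ω → ℂ}
    {c : ℕ → ℝ → Bg → Finset α → Ω → F → ℂ} {pt : ℕ → ℝ → Bg → Finset α → Ω → F → Sp} {β : ℕ → Sp → ℝ}
    {lip ε : ℕ → ℝ} {y a₁ d₁ θ κ lipbar ℓ τbar ω : ℝ} {wt : ℕ → ι → ℝ} {τ : ℕ → ℕ → ℝ} {lam : ℕ → ℝ}
    (ρ : ℕ → (ι → ℝ) → (Sp →ᵇ ℂ))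
    -- recursion side (displayed, named binders of the sibling leaves)
    (h0 : ScaleZeroFree E W) (hAdm : AdmissibleTerms E W Adm) (hres : AdmRestrict Adm)
    (hadd : ChannelAdditive Adm T) (hsum : ChannelStepSum Adm T) (hstep : ChannelSizeAtStepNN Adm T κ wt τ)
    (hfac : Factorises E W T Ψ) (hlast : LastCouplingLipschitz E W T Ψ κ lam)
    (hρ : ∀ (k : ℕ) (P P' : ι → ℝ) (M : ℝ), (∀ y, |P y - P' y| ≤ wt k y * M) → ‖ρ k P - ρ k P'‖ ≤ M)
    (hΨ : ∀ (k : ℕ) (s : ℝ) (P P' : ι → ℝ) (U : Bg) (X : C.Dom),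
      Ψ k s P U X - Ψ k s P' U X =
        (Γ.geom.newTerm (Γ.geom.avgExpLinearAct μ pre fun k s U γ ω => evalFunctional (c k s U γ ω) (pt k s U γ ω))
            k s U X (ρ k P) -
          Γ.geom.newTerm (Γ.geom.avgExpLinearAct μ pre fun k s U γ ω => evalFunctional (c k s U γ ω) (pt k s U γ ω))
            k s U X (ρ k P')).re)
    -- occupation: occurring tables lie in the box (TYPE (1.36)); no radius
    (hocc : ∀ g ∈ W, ∀ g' ∈ W, ∀ (k : ℕ) (x : Sp), ‖ρ k (T k g' (E g)) x‖ ≤ β k x)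
    -- activity side: regularity data, scales, ONE integrability (TYPE (2.23)-(2.25)), (L′) scale bound, (A″) box-majorant decay
    (hpre : ∀ k s U γ, AEStronglyMeasurable (pre k s U γ) (μ k s U γ))
    (hc : ∀ k s U γ Y, AEStronglyMeasurable (fun ω => c k s U γ ω Y) (μ k s U γ))
    (hpt : ∀ k s U γ Y, Measurable fun ω => pt k s U γ ω Y) (hlip : ∀ k, 0 < lip k) (hlipb : ∀ k, lip k ≤ lipbar)
    (hint₀ : ∀ k s U γ, Integrable (fun ω => ‖pre k s U γ ω‖ * Real.exp (boxExponent c pt β k s U γ ω)) (μ k s U γ))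
    (hL : ∀ k s U (γ : Finset α) ω, coeffSum c k s U γ ω ≤ lip k * (γ.card : ℝ))
    (hε : ∀ k, 0 ≤ ε k) (hy : 0 ≤ y)
    (hdecay₀ : ∀ g ∈ W, ∀ (k : ℕ) (U : Bg) (X : C.Dom), C.scale X = k + 1 → ∀ γ' ∈ Γ.vol X,
      ∫ ω, ‖pre k (g k) U γ' ω‖ * Real.exp (boxExponent c pt β k (g k) U γ' ω) ∂(μ k (g k) U γ') ≤ ε k * y ^ γ'.card)
    -- (C) scalar smallness (decay base 2y) and the envelope data
    (hθ : 2 * y * Real.exp (a₁ + d₁) * Real.exp (D * θ) ≤ θ) (hεθ : ∀ k, 2 * ε k * θ * ((D : ℝ) + 1) ≤ a₁)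
    (ha₁ : 0 ≤ a₁) (hκ : 0 ≤ κ) (hκd : κ ≤ d₁) (hℓ : 0 ≤ ℓ) (hτbar : 0 ≤ τbar) (hω : 0 ≤ ω)
    (hpos : 0 < ω + 4 * lipbar * a₁ * τbar) (hlam : ∀ k, lam k ≤ ℓ)
    (hτ : ∀ k j, j ≤ k → 0 ≤ τ k j ∧ τ k j ≤ τbar * ω ^ (k - j)) :
    NE9 E W κ (prodModuli ℓ fun _ => ω + 4 * lipbar * a₁ * τbar) ∧
      FadingMemory (ℓ / (ω + 4 * lipbar * a₁ * τbar)) (ω + 4 * lipbar * a₁ * τbar)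
        (prodModuli ℓ fun _ => ω + 4 * lipbar * a₁ * τbar) := by
  have hint₁ : ∀ k s U γ, Integrable
      (fun ω => ‖pre k s U γ ω‖ * coeffSum c k s U γ ω * Real.exp (boxExponent c pt β k s U γ ω)) (μ k s U γ) :=
    fun k s U γ => integrable_weighted_of_le (aestronglyMeasurable_coeffSum hc k s U γ) (coeffSum_nonneg c k s U γ)
      (hL k s U γ) (hint₀ k s U γ)
  have hy2 : 0 ≤ 2 * y := by positivity
  refine cubeChart_ne9_and_fadingMemory_of_box Γ ρ h0 hAdm hres hadd hsum hstep hfac hlast hρ hΨ hocc hpre hc hpt hlip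
    hlipb hint₀ hint₁ hε hy2 (fun g hg k U X hX γ' hγ' => ?_) hθ hεθ ha₁ hκ hκd hℓ hτbar hω hpos hlam hτ
  calc segMajorant μ pre (coeffSum c) (boxExponent c pt β) lip k (g k) U γ'
      ≤ (1 + (γ'.card : ℝ)) *
          ∫ ω, ‖pre k (g k) U γ' ω‖ * Real.exp (boxExponent c pt β k (g k) U γ' ω) ∂(μ k (g k) U γ') :=
        segMajorant_le_one_add_mul (hlip k) (coeffSum_nonneg c k (g k) U γ') (hL k (g k) U γ') (hint₀ k (g k) U γ')
    _ ≤ (1 + (γ'.card : ℝ)) * (ε k * y ^ γ'.card) :=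
        mul_le_mul_of_nonneg_left (hdecay₀ g hg k U X hX γ' hγ') (by positivity)
    _ = ε k * ((1 + (γ'.card : ℝ)) * y ^ γ'.card) := by ring
    _ ≤ ε k * (2 * y) ^ γ'.card := mul_le_mul_of_nonneg_left (one_add_mul_pow_le hy _) (hε k)

end EndToEndBoxMajorant

/-! ## §8 NON-VACUITY of TWO-POINT KP and of §3 on the nonlinear toy recursion of the sibling leaf -/

section Toy

/-- **TWO-POINT KP for the toy** (one polymer, linear activity `μQ` on `ℂ`, `T4HistoryLipschitzActivity` §5) on ANY window:
admissible set the disc `‖Q‖ ≤ 3/2` (the occurring size), majorant `n ≡ 2μ` (`‖μQ‖ ≤ (3/2)μ ≤ 2μ`, `‖μQ − μQ′‖ = μ‖Q − Q′‖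
≤ 1·‖Q − Q′‖·2μ`), scale `lip ≡ 1`, `a ≡ 1`, `d ≡ 0`, KP for `2n`: `4μe ≤ 1`, implied by the toy's `6μe ≤ 1`. [folklore] -/
theorem kpToy_twoPointKP {μ : ℝ} (hμ : 0 ≤ μ) (hμ1 : 6 * μ * Real.exp 1 ≤ 1) (W : Set (ℕ → ℝ)) :
    TwoPointKP kpToyGeom W (kpToyAct μ) (fun _ => closedBall (0 : ℂ) (3 / 2)) (fun _ _ _ _ => 2 * μ) (fun _ => 1)
      (fun _ => 1) (fun _ => 0) := by
  refine ⟨fun _ => zero_le_one, fun _ => le_rfl, fun _ => zero_le_one, fun g _ k U X _ => ⟨?_, ?_, ?_⟩⟩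
  · intro Q hQ γ _
    show ‖(μ : ℂ) * Q‖ ≤ 2 * μ
    rw [mem_closedBall_zero_iff] at hQ
    rw [norm_mul, Complex.norm_real, Real.norm_eq_abs, abs_of_nonneg hμ]
    nlinarith [norm_nonneg Q]
  · intro Q _ Q' _ γ _
    show ‖(μ : ℂ) * Q - (μ : ℂ) * Q'‖ ≤ (fun _ : ℕ => (1 : ℝ)) k * ‖Q - Q'‖ * (2 * μ)
    rw [← mul_sub, norm_mul, Complex.norm_real, Real.norm_eq_abs, abs_of_nonneg hμ]
    show μ * ‖Q - Q'‖ ≤ 1 * ‖Q - Q'‖ * (2 * μ)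
    nlinarith [norm_nonneg (Q - Q')]
  · intro γ _
    calc ∑ γ' ∈ kpToyGeom.vol X with kpToyGeom.inc γ' γ,
          2 * (fun (_ : ℕ) (_ : ℝ) (_ : Unit) (_ : Unit) => 2 * μ) k (g k) U γ' *
            Real.exp ((fun _ : Unit => (1 : ℝ)) γ' + (fun _ : Unit => (0 : ℝ)) γ')
        ≤ ∑ γ' ∈ kpToyGeom.vol X, 2 * (fun (_ : ℕ) (_ : ℝ) (_ : Unit) (_ : Unit) => 2 * μ) k (g k) U γ' *
            Real.exp ((fun _ : Unit => (1 : ℝ)) γ' + (fun _ : Unit => (0 : ℝ)) γ') :=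
          Finset.sum_le_sum_of_subset_of_nonneg (Finset.filter_subset _ _) fun _ _ _ => by positivity
      _ = 4 * μ * Real.exp 1 := by
          rw [kpToyGeom_vol, Finset.sum_singleton]
          simp only [add_zero]
          ring
      _ ≤ (fun _ : Unit => (1 : ℝ)) γ := by
          show 4 * μ * Real.exp 1 ≤ 1
          nlinarith [Real.exp_pos 1]

/-- **`OutputLipschitz` for the toy by the RADIUS-FREE route** (non-vacuity of §3 on a nonlinear recursion): for `0 ≤ μ`,
`6μe ≤ 1` and histories with `|g_i| ≤ ½` (occurring size `3/2`, `T4HistoryLipschitzActivity.kpToy_occ`), §3 gives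
`OutputLipschitz` with the constant `4·lip·B₀ = 4·1·1` (pin budget `B₀ ≡ 1`, κ = 0).  The constant is not optimised (the
Cauchy route of the sibling leaf gives `8/9` on this toy with `R₀ = 6`); the point is that no radius enters. [folklore] -/
theorem kpToy_outputLipschitz_twoPoint {μ : ℝ} (hμ : 0 ≤ μ) (hμ1 : 6 * μ * Real.exp 1 ≤ 1) {W : Set (ℕ → ℝ)}
    (hW : ∀ g ∈ W, ∀ i, |g i| ≤ 1 / 2) :
    OutputLipschitz (C := toyCarriers) (kpToyE μ) W toyChannel (kpToyΨ μ) 0 (fun _ _ => 1) (fun _ => 4 * 1 * 1) :=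
  outputLipschitz_of_twoPointKP kpToyGeom kpToyRead (kpToy_twoPointKP hμ hμ1 W) kpToy_decayExtract kpToy_pinBudget
    kpToy_read (kpToy_psi_sub μ) fun g hg g' hg' k => mem_closedBall_zero_iff.2 (kpToy_occ hμ hμ1 hW g hg g' hg' k)

end Toy

/-! ## §9 (v1.2) THE JOINT SIZE INDUCTION: the (I.1.18)-type size bound for EVERY history of the window and the BOX
OCCUPATION of the hybrid tables, DERIVED — the printed mechanism of [II] p. 21 -/

section SizeInduction

variable {C : Carriers} (G : ClusterGeom C) {Bg : Type} {Pot : Type*} [NormedAddCommGroup Pot]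

/-- SHAPE S-SIZE-E (the INDUCTIVE SIZE BOUND of the effective-action terms — the conclusion of §9, a binder elsewhere;
asserted nowhere about Bałaban's terms): every term of every history of the window is bounded by `N(creation step)·e^{−κd}`.
Print, [I] p. 263: *"There exists a constant E₀ such that |𝐄^{(j)}(X, g_{j−1}, 𝐔, 𝐉)| ≦ E₀ exp(−κd_j(X))"* (1.18), and
(0.25) p. 257 *"|𝐄^{(j)}(X, U)| ≦ E₀ exp(−κd_j(X))"* — ONE constant; the creation-step profile `N j` is this module's
bookkeeping generality (`N ≡ E₀` is the printed case). [cite: Balaban1987RG1, (0.25) p.257, (1.18) p.263] -/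
def TermSize (E : Functional C Bg) (W : Set (ℕ → ℝ)) (κ : ℝ) (N : ℕ → ℝ) : Prop :=
  ∀ g ∈ W, ∀ (U : Bg) (X : C.Dom), |E g U X| ≤ Real.exp (-(κ * C.d X)) * N (C.scale X)

/-- the RADIUS of the weighted output box at the step k generated by a size profile `N`: `Σ_{j≤k} τ k j·N j` — the
right-hand side of `ChannelSizeNN` (TYPE: (1.36) p. 9 of [II] summed over the creation steps with the factors `L^jη` of
p. 8). [cite: Balaban1988RG2Cluster, (1.29) p.8, (1.36) p.9] -/
def sizeRadius (τ : ℕ → ℕ → ℝ) (N : ℕ → ℝ) (k : ℕ) : ℝ := ∑ j ∈ Finset.range (k + 1), τ k j * N j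

/-- the radius is nonnegative for nonnegative weights and sizes. [folklore] -/
theorem sizeRadius_nonneg {τ : ℕ → ℕ → ℝ} {N : ℕ → ℝ} (hτ : ∀ k j, j ≤ k → 0 ≤ τ k j) (hN : ∀ j, 0 ≤ N j) (k : ℕ) :
    0 ≤ sizeRadius τ N k :=
  Finset.sum_nonneg fun j hj => mul_nonneg (hτ k j (Nat.lt_succ_iff.mp (Finset.mem_range.mp hj))) (hN j)

/-- **UNIFORM RADIUS (kernel)**: geometric weights `0 ≤ τ k j ≤ τ̄ω^{k−j}` (`0 ≤ ω < 1`) and a bounded profile `0 ≤ N j ≤ N̄`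
give `sizeRadius τ N k ≤ τ̄/(1 − ω)·N̄` for every k (∘ `sum_geometricWeights_le`; print's *"the sum over j is bounded by
2(6L)^4"* p. 8 of [II]). [cite: Balaban1988RG2Cluster, p.8 l.9-10] -/
theorem sizeRadius_le_of_geometric {τ : ℕ → ℕ → ℝ} {N : ℕ → ℝ} {τbar ω Nbar : ℝ} (hτbar : 0 ≤ τbar) (hω : 0 ≤ ω)
    (hω1 : ω < 1) (hτ : ∀ k j, j ≤ k → 0 ≤ τ k j ∧ τ k j ≤ τbar * ω ^ (k - j)) (hN : ∀ j, 0 ≤ N j ∧ N j ≤ Nbar)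
    (k : ℕ) : sizeRadius τ N k ≤ τbar / (1 - ω) * Nbar := by
  unfold sizeRadius
  calc ∑ j ∈ Finset.range (k + 1), τ k j * N j ≤ ∑ j ∈ Finset.range (k + 1), τ k j * Nbar :=
        Finset.sum_le_sum fun j hj =>
          mul_le_mul_of_nonneg_left (hN j).2 (hτ k j (Nat.lt_succ_iff.mp (Finset.mem_range.mp hj))).1
    _ = (∑ j ∈ Finset.range (k + 1), τ k j) * Nbar := by rw [Finset.sum_mul]
    _ ≤ τbar / (1 - ω) * Nbar :=
        mul_le_mul_of_nonneg_right (sum_geometricWeights_le hτbar hω hω1 hτ k) ((hN 0).1.trans (hN 0).2)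

/-- **CHANNEL OUTPUTS IN THE WEIGHTED BOX (kernel)**: if the terms of `g ∈ W` created at the steps `≤ k` obey a nonnegative
size profile `N`, then every step-k channel output of these terms — for ANY comparison history `s`, the hybrid ones
included — satisfies `|T k s (E g) y| ≤ wt k y·sizeRadius τ N k` (`ChannelSizeNN` at `E g ∈ Adm`). [folklore] -/
theorem channelOutput_le_of_sizes {ι : Type} {E : Functional C Bg} {W : Set (ℕ → ℝ)} {Adm : Set (Bg → C.Dom → ℝ)}
    {T : ℕ → (ℕ → ℝ) → (Bg → C.Dom → ℝ) → ι → ℝ} {κ : ℝ} {wt : ℕ → ι → ℝ} {τ : ℕ → ℕ → ℝ} {N : ℕ → ℝ}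
    (hAdm : AdmissibleTerms E W Adm) (hsize : ChannelSizeNN Adm T κ wt τ) (hNnn : ∀ j, 0 ≤ N j) {g : ℕ → ℝ}
    (hg : g ∈ W) {k : ℕ}
    (hk : ∀ (U : Bg) (X : C.Dom), C.scale X ≤ k → |E g U X| ≤ Real.exp (-(κ * C.d X)) * N (C.scale X))
    (s : ℕ → ℝ) (y : ι) : |T k s (E g) y| ≤ wt k y * sizeRadius τ N k :=
  hsize k s (E g) (hAdm.1 g hg) N hNnn hk y

omit [NormedAddCommGroup Pot] in
/-- **(R′) FROM A UNIFORM RADIUS (kernel)**: with nonnegative channel weights, geometric step weights (`0 ≤ ω < 1`) and a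
bounded profile `0 ≤ N j ≤ N̄`, a read-out mapping the weighted output box of the UNIFORM radius `τ̄/(1 − ω)·N̄` into the
admissible sets maps every box of radius `sizeRadius τ N k` into them (print's shape: ONE constant for all steps, (1.36)
p. 9 with *"the sum over j is bounded by 2(6L)⁴"* p. 8 of [II]). [cite: Balaban1988RG2Cluster, p.8 l.9-10, (1.36) p.9] -/
theorem boxRead_of_uniformRadius {ι : Type} {𝒜 : ℕ → Set Pot} {wt : ℕ → ι → ℝ} {τ : ℕ → ℕ → ℝ} {N : ℕ → ℝ}
    {τbar ω Nbar : ℝ} (ρ : ℕ → (ι → ℝ) → Pot) (hwt : ∀ k y, 0 ≤ wt k y) (hτbar : 0 ≤ τbar) (hω : 0 ≤ ω)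
    (hω1 : ω < 1) (hτ : ∀ k j, j ≤ k → 0 ≤ τ k j ∧ τ k j ≤ τbar * ω ^ (k - j)) (hN : ∀ j, 0 ≤ N j ∧ N j ≤ Nbar)
    (hread : ∀ (k : ℕ) (P : ι → ℝ), (∀ y, |P y| ≤ wt k y * (τbar / (1 - ω) * Nbar)) → ρ k P ∈ 𝒜 k) :
    ∀ (k : ℕ) (P : ι → ℝ), (∀ y, |P y| ≤ wt k y * sizeRadius τ N k) → ρ k P ∈ 𝒜 k :=
  fun k P hP => hread k P fun y =>
    (hP y).trans (mul_le_mul_of_nonneg_left (sizeRadius_le_of_geometric hτbar hω hω1 hτ hN k) (hwt k y))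

omit [NormedAddCommGroup Pot] in
/-- **THE TABLE-INDEPENDENT PART IS TABLE-INDEPENDENT (kernel remark)**: under the cluster-sum factorisation `hΨ` of the
sibling leaves (the output configuration enters the new term ONLY through the cluster sum read at `ρ k P`), the difference
`Ψ k s P − Re newTerm(ρ k P)` does not depend on `P`. [folklore] -/
theorem explicitPart_indep {ι : Type} {Ψ : ℕ → ℝ → (ι → ℝ) → Bg → C.Dom → ℝ} {act : ℕ → ℝ → Bg → Pot → G.P → ℂ}
    (ρ : ℕ → (ι → ℝ) → Pot)
    (hΨ : ∀ (k : ℕ) (s : ℝ) (P P' : ι → ℝ) (U : Bg) (X : C.Dom),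
      Ψ k s P U X - Ψ k s P' U X = (G.newTerm act k s U X (ρ k P) - G.newTerm act k s U X (ρ k P')).re)
    (k : ℕ) (s : ℝ) (P P' : ι → ℝ) (U : Bg) (X : C.Dom) :
    Ψ k s P U X - (G.newTerm act k s U X (ρ k P)).re = Ψ k s P' U X - (G.newTerm act k s U X (ρ k P')).re := by
  have h := hΨ k s P P' U X
  rw [Complex.sub_re] at h
  linarith

omit [NormedAddCommGroup Pot] in
/-- Hence a bound on the table-independent part at ONE reference output configuration `P₀ k` per step is a bound at every
output configuration — the form (X) in which `termSize_of_recursion` displays it. [folklore] -/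
theorem explicitBound_of_reference {ι : Type} {W : Set (ℕ → ℝ)} {Ψ : ℕ → ℝ → (ι → ℝ) → Bg → C.Dom → ℝ}
    {act : ℕ → ℝ → Bg → Pot → G.P → ℂ} {κ : ℝ} {p₀ : ℕ → ℝ} (ρ : ℕ → (ι → ℝ) → Pot) (P₀ : ℕ → ι → ℝ)
    (hΨ : ∀ (k : ℕ) (s : ℝ) (P P' : ι → ℝ) (U : Bg) (X : C.Dom),
      Ψ k s P U X - Ψ k s P' U X = (G.newTerm act k s U X (ρ k P) - G.newTerm act k s U X (ρ k P')).re)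
    (href : ∀ g ∈ W, ∀ (k : ℕ) (U : Bg) (X : C.Dom), C.scale X = k + 1 →
      |Ψ k (g k) (P₀ k) U X - (G.newTerm act k (g k) U X (ρ k (P₀ k))).re| ≤ Real.exp (-(κ * C.d X)) * p₀ k) :
    ∀ g ∈ W, ∀ (k : ℕ) (P : ι → ℝ) (U : Bg) (X : C.Dom), C.scale X = k + 1 →
      |Ψ k (g k) P U X - (G.newTerm act k (g k) U X (ρ k P)).re| ≤ Real.exp (-(κ * C.d X)) * p₀ k := by
  intro g hg k P U X hX
  rw [explicitPart_indep G ρ hΨ k (g k) P (P₀ k) U X]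
  exact href g hg k U X hX

/-- **THE JOINT SIZE INDUCTION (kernel) — the printed mechanism of [II] p. 21, typed.**  Print closes the induction on the
size bound (I.1.18) at the end of [II]: (2.41) p. 21 *"|𝐄^{(k+1)}(X)| ≦ O(1)C₃ε₁ exp(−(1 − 10δ)½Lκd_{k+1}(X))"*, then
*"Next, we assume that O(1)C₃ε₁ ≦ ½E₀."* and *"The inequality (2.41) and the assumptions imply the inequality (I.1.18), with
½E₀ instead of E₀, for the terms of the effective action 𝐄^{(k+1)} in (I.1.3). The effective action in (I.1.6) is obtained
by adding to the above action the expression [log Z^{(k)}(U_{k+1}) − log Z^{(k)}(1)]."*, the latter satisfying *"the bound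
(I.1.18) with κ replaced by δ₀M, and with an absolute constant instead of E₀. We define ½E₀ as equal to this constant"*.
ABSTRACTLY, over the binders of the sibling leaves: GIVEN `AdmissibleTerms`, the weighted channel size bound `ChannelSizeNN …
wt τ` (∘ `channelSizeNN_of_perStepNN`), `Factorises`, TWO-POINT KP on admissible sets `𝒜 k` (only its UNIFORM clause is used,
through `norm_newTerm_le_of_twoPointKP`: `‖newTerm Q‖ ≤ B₀ k·e^{−κd}` for admissible `Q` — TYPE (2.41)), `DecayExtract`,
`PinBudget … B₀ κ`, and the four displayed data (B0) a base size at scale 0 (TYPE (0.23) p. 256 of [I]: nothing is created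
before the first step), (X) a WINDOW-UNIFORM bound `e^{−κd}·p₀ k` on the TABLE-INDEPENDENT part `Ψ k (g k) P − Re newTerm(ρ k P)`
of the new term (TYPE: the contributions not produced by the cluster expansion in the old tables — in print the added
expression of p. 21 with its *"absolute constant"* `½E₀`; the identification is a READING, displayed; `P`-independent by
`explicitPart_indep`), (N) a nonnegative size profile with `p₀ j + B₀ j ≤ N (j+1)` (TYPE: `½E₀ + ½E₀ = E₀` of p. 21), (R′) the
read-out `ρ k` maps the weighted output box of radius `sizeRadius τ N k` INTO the admissible set `𝒜 k` (TYPE: (2.19)–(2.20)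
p. 16 of [II], the table sizes entering the exponent bound) — THEN, by strong induction on the creation step: every history of
the window obeys `TermSize E W κ N`, AND every occurring output configuration `ρ k (T k g′ (E g))`, `g, g′ ∈ W` — the HYBRID
ones (terms of `g` localized with the channel of `g′`) included — is admissible.  The second conclusion is exactly the
occupation hypothesis `hocc` of `outputLipschitz_of_twoPointKP` / §7 / §7b, which is thereby DERIVED from (B0), (X), (N), (R′).
Nothing about [I]–[III] is asserted; rung (B)+1 bookkeeping. [cite: Balaban1988RG2Cluster, (2.41) p.21 and p.21 text; Balaban1987RG1, (0.23) p.256, (1.18) p.263] -/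
theorem termSize_of_recursion {ι : Type} {E : Functional C Bg} {W : Set (ℕ → ℝ)} {Adm : Set (Bg → C.Dom → ℝ)}
    {T : ℕ → (ℕ → ℝ) → (Bg → C.Dom → ℝ) → ι → ℝ} {Ψ : ℕ → ℝ → (ι → ℝ) → Bg → C.Dom → ℝ}
    {act : ℕ → ℝ → Bg → Pot → G.P → ℂ} {𝒜 : ℕ → Set Pot} {n : ℕ → ℝ → Bg → G.P → ℝ} {lip : ℕ → ℝ} {a d : G.P → ℝ}
    {δ : C.Dom → ℝ} {B₀ p₀ N : ℕ → ℝ} {κ : ℝ} {wt : ℕ → ι → ℝ} {τ : ℕ → ℕ → ℝ} (ρ : ℕ → (ι → ℝ) → Pot)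
    (hAdm : AdmissibleTerms E W Adm) (hsize : ChannelSizeNN Adm T κ wt τ) (hfac : Factorises E W T Ψ)
    (hK : TwoPointKP G W act 𝒜 n lip a d) (hdec : G.DecayExtract δ d) (hpin : G.PinBudget a δ B₀ κ)
    (hexpl : ∀ g ∈ W, ∀ (k : ℕ) (P : ι → ℝ) (U : Bg) (X : C.Dom), C.scale X = k + 1 →
      |Ψ k (g k) P U X - (G.newTerm act k (g k) U X (ρ k P)).re| ≤ Real.exp (-(κ * C.d X)) * p₀ k)
    (hbase : ∀ g ∈ W, ∀ (U : Bg) (X : C.Dom), C.scale X = 0 → |E g U X| ≤ Real.exp (-(κ * C.d X)) * N 0)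
    (hNsucc : ∀ j, p₀ j + B₀ j ≤ N (j + 1)) (hNnn : ∀ j, 0 ≤ N j)
    (hbox : ∀ (k : ℕ) (P : ι → ℝ), (∀ y, |P y| ≤ wt k y * sizeRadius τ N k) → ρ k P ∈ 𝒜 k) :
    TermSize E W κ N ∧ ∀ g ∈ W, ∀ g' ∈ W, ∀ k : ℕ, ρ k (T k g' (E g)) ∈ 𝒜 k := by
  have main : ∀ (m : ℕ), ∀ g ∈ W, ∀ (U : Bg) (X : C.Dom), C.scale X ≤ m →
      |E g U X| ≤ Real.exp (-(κ * C.d X)) * N (C.scale X) := by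
    intro m
    induction m with
    | zero =>
        intro g hg U X hX
        have h0 : C.scale X = 0 := Nat.le_zero.mp hX
        rw [h0]
        exact hbase g hg U X h0
    | succ k ih =>
        intro g hg U X hX
        rcases Nat.lt_or_ge (C.scale X) (k + 1) with hlt | hge
        · exact ih g hg U X (Nat.lt_succ_iff.mp hlt)
        · have hXk : C.scale X = k + 1 := le_antisymm hX hge
          have hocc : ρ k (T k g (E g)) ∈ 𝒜 k :=
            hbox k _ fun y => hsize k g (E g) (hAdm.1 g hg) N hNnn (fun U' X' hX' => ih g hg U' X' hX') y
          have hnew := norm_newTerm_le_of_twoPointKP G hK hdec hpin hg hXk (U := U) hocc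
          have he := hexpl g hg k (T k g (E g)) U X hXk
          have hre : |(G.newTerm act k (g k) U X (ρ k (T k g (E g)))).re| ≤ B₀ k * Real.exp (-(κ * C.d X)) :=
            (Complex.abs_re_le_norm _).trans hnew
          rw [hfac g hg k U X hXk, hXk]
          calc |Ψ k (g k) (T k g (E g)) U X|
              = |Ψ k (g k) (T k g (E g)) U X - (G.newTerm act k (g k) U X (ρ k (T k g (E g)))).re +
                  (G.newTerm act k (g k) U X (ρ k (T k g (E g)))).re| := by rw [sub_add_cancel]
            _ ≤ |Ψ k (g k) (T k g (E g)) U X - (G.newTerm act k (g k) U X (ρ k (T k g (E g)))).re| +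
                  |(G.newTerm act k (g k) U X (ρ k (T k g (E g)))).re| := abs_add_le _ _
            _ ≤ Real.exp (-(κ * C.d X)) * p₀ k + B₀ k * Real.exp (-(κ * C.d X)) := add_le_add he hre
            _ = Real.exp (-(κ * C.d X)) * (p₀ k + B₀ k) := by ring
            _ ≤ Real.exp (-(κ * C.d X)) * N (k + 1) := mul_le_mul_of_nonneg_left (hNsucc k) (Real.exp_nonneg _)
  have hT : TermSize E W κ N := fun g hg U X => main (C.scale X) g hg U X le_rfl
  exact ⟨hT, fun g hg g' _ k => hbox k _ fun y => hsize k g' (E g) (hAdm.1 g hg) N hNnn (fun U X _ => hT g hg U X) y⟩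

end SizeInduction

/-! ## §9b END-TO-END on a cube chart with the occupation DERIVED: NE9 ∧ FadingMemory (and the size bound) from the
base, the table-independent part, `p₀ + a₁ ≤ N` and the read-out of the weighted output box -/

section EndToEndSizeInduction

open BoundedContinuousFunction

variable {C : Carriers} {α : Type} [DecidableEq α] {adj : α → α → Prop} [DecidableRel adj] [Std.Symm adj] {D : ℕ}
variable {Bg : Type} {Sp : Type*} [TopologicalSpace Sp] [MeasurableSpace Sp] [OpensMeasurableSpace Sp] {F : Type*}
  [Fintype F] {Ω : Type*} [MeasurableSpace Ω]

/-- **THE SIZE BOUND AND THE BOX OCCUPATION ON A CUBE CHART (kernel).**  Under the §7b activity side (regularity data,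
scales `0 < lip k`, ONE integrability, (L′), (A″) box-majorant decay on the box `β`, smallness (C) with base `2y`) and the
recursion-side binders `AdmissibleTerms`, `AdmRestrict`, `ChannelStepSum`, `ChannelSizeAtStepNN … wt τ`, `Factorises`, the
data (B0) base size, (X) table-independent part `≤ e^{−κd}·p₀ k`, (N) profile with `p₀ j + a₁ ≤ N (j+1)` (the pin budget of
the chart is the constant `a₁`), (R′) `ρ k` reads the weighted output box of radius `sizeRadius τ N k` into the box `β k`
pointwise: EVERY history of the window obeys `TermSize E W κ N` and every occurring (hybrid) table lies in the box —
`termSize_of_recursion` ∘ `twoPointKP_of_avgEvalExpLinear_box_decay` ∘ the chart's `decayExtract` / `pinBudget`.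
[cite: Balaban1988RG2Cluster, (2.19)-(2.20) p.16, (2.26) p.17, (2.41) p.21 and p.21 text; Balaban1987RG1, (0.23) p.256, (1.18) p.263] -/
theorem cubeChart_termSize_and_boxOcc (Γ : CubeChart C α adj D) {ι : Type} {E : Functional C Bg}
    {W : Set (ℕ → ℝ)} {Adm : Set (Bg → C.Dom → ℝ)} {T : ℕ → (ℕ → ℝ) → (Bg → C.Dom → ℝ) → ι → ℝ}
    {Ψ : ℕ → ℝ → (ι → ℝ) → Bg → C.Dom → ℝ}
    {μ : ℕ → ℝ → Bg → Finset α → Measure Ω} {pre : ℕ → ℝ → Bg → Finset α → Ω → ℂ}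
    {c : ℕ → ℝ → Bg → Finset α → Ω → F → ℂ} {pt : ℕ → ℝ → Bg → Finset α → Ω → F → Sp} {β : ℕ → Sp → ℝ}
    {lip ε : ℕ → ℝ} {y a₁ d₁ θ κ : ℝ} {wt : ℕ → ι → ℝ} {τ : ℕ → ℕ → ℝ} {p₀ N : ℕ → ℝ}
    (ρ : ℕ → (ι → ℝ) → (Sp →ᵇ ℂ))
    -- recursion side (displayed, named binders of the sibling leaves)
    (hAdm : AdmissibleTerms E W Adm) (hres : AdmRestrict Adm) (hsum : ChannelStepSum Adm T)
    (hstep : ChannelSizeAtStepNN Adm T κ wt τ) (hfac : Factorises E W T Ψ)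
    -- the size-induction data (B0), (X), (N), (R′) — in place of an occupation hypothesis
    (hexpl : ∀ g ∈ W, ∀ (k : ℕ) (P : ι → ℝ) (U : Bg) (X : C.Dom), C.scale X = k + 1 →
      |Ψ k (g k) P U X -
          (Γ.geom.newTerm (Γ.geom.avgExpLinearAct μ pre fun k s U γ ω => evalFunctional (c k s U γ ω) (pt k s U γ ω))
            k (g k) U X (ρ k P)).re| ≤ Real.exp (-(κ * C.d X)) * p₀ k)
    (hbase : ∀ g ∈ W, ∀ (U : Bg) (X : C.Dom), C.scale X = 0 → |E g U X| ≤ Real.exp (-(κ * C.d X)) * N 0)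
    (hNsucc : ∀ j, p₀ j + a₁ ≤ N (j + 1)) (hNnn : ∀ j, 0 ≤ N j)
    (hbox : ∀ (k : ℕ) (P : ι → ℝ), (∀ y, |P y| ≤ wt k y * sizeRadius τ N k) → ∀ x, ‖ρ k P x‖ ≤ β k x)
    -- activity side: regularity data, scales, ONE integrability, (L′) scale bound, (A″) box-majorant decay
    (hpre : ∀ k s U γ, AEStronglyMeasurable (pre k s U γ) (μ k s U γ))
    (hc : ∀ k s U γ Y, AEStronglyMeasurable (fun ω => c k s U γ ω Y) (μ k s U γ))
    (hpt : ∀ k s U γ Y, Measurable fun ω => pt k s U γ ω Y) (hlip : ∀ k, 0 < lip k)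
    (hint₀ : ∀ k s U γ, Integrable (fun ω => ‖pre k s U γ ω‖ * Real.exp (boxExponent c pt β k s U γ ω)) (μ k s U γ))
    (hL : ∀ k s U (γ : Finset α) ω, coeffSum c k s U γ ω ≤ lip k * (γ.card : ℝ))
    (hε : ∀ k, 0 ≤ ε k) (hy : 0 ≤ y)
    (hdecay₀ : ∀ g ∈ W, ∀ (k : ℕ) (U : Bg) (X : C.Dom), C.scale X = k + 1 → ∀ γ' ∈ Γ.vol X,
      ∫ ω, ‖pre k (g k) U γ' ω‖ * Real.exp (boxExponent c pt β k (g k) U γ' ω) ∂(μ k (g k) U γ') ≤ ε k * y ^ γ'.card)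
    -- (C) scalar smallness (decay base 2y)
    (hθ : 2 * y * Real.exp (a₁ + d₁) * Real.exp (D * θ) ≤ θ) (hεθ : ∀ k, 2 * ε k * θ * ((D : ℝ) + 1) ≤ a₁)
    (ha₁ : 0 ≤ a₁) (hκ : 0 ≤ κ) (hκd : κ ≤ d₁) :
    TermSize E W κ N ∧ ∀ g ∈ W, ∀ g' ∈ W, ∀ (k : ℕ) (x : Sp), ‖ρ k (T k g' (E g)) x‖ ≤ β k x := by
  have hd₁ : 0 ≤ d₁ := hκ.trans hκd
  have hint₁ : ∀ k s U γ, Integrable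
      (fun ω => ‖pre k s U γ ω‖ * coeffSum c k s U γ ω * Real.exp (boxExponent c pt β k s U γ ω)) (μ k s U γ) :=
    fun k s U γ => integrable_weighted_of_le (aestronglyMeasurable_coeffSum hc k s U γ) (coeffSum_nonneg c k s U γ)
      (hL k s U γ) (hint₀ k s U γ)
  have hy2 : 0 ≤ 2 * y := by positivity
  have hdecay : ∀ g ∈ W, ∀ (k : ℕ) (U : Bg) (X : C.Dom), C.scale X = k + 1 → ∀ γ' ∈ Γ.vol X,
      segMajorant μ pre (coeffSum c) (boxExponent c pt β) lip k (g k) U γ' ≤ ε k * (2 * y) ^ γ'.card := by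
    intro g hg k U X hX γ' hγ'
    calc segMajorant μ pre (coeffSum c) (boxExponent c pt β) lip k (g k) U γ'
        ≤ (1 + (γ'.card : ℝ)) *
            ∫ ω, ‖pre k (g k) U γ' ω‖ * Real.exp (boxExponent c pt β k (g k) U γ' ω) ∂(μ k (g k) U γ') :=
          segMajorant_le_one_add_mul (hlip k) (coeffSum_nonneg c k (g k) U γ') (hL k (g k) U γ') (hint₀ k (g k) U γ')
      _ ≤ (1 + (γ'.card : ℝ)) * (ε k * y ^ γ'.card) :=
          mul_le_mul_of_nonneg_left (hdecay₀ g hg k U X hX γ' hγ') (by positivity)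
      _ = ε k * ((1 + (γ'.card : ℝ)) * y ^ γ'.card) := by ring
      _ ≤ ε k * (2 * y) ^ γ'.card := mul_le_mul_of_nonneg_left (one_add_mul_pow_le hy _) (hε k)
  have hKP := twoPointKP_of_avgEvalExpLinear_box_decay Γ.supported (W := W) (μ := μ) (pre := pre) (c := c) (pt := pt)
    (β := β) (ε := ε) ha₁ hd₁ hlip hpre hc hpt hint₀ hint₁ hε hy2
    (fun g hg k U X hX γ' hγ' => hdecay g hg k U X hX γ' hγ') hθ hεθ
  have h := termSize_of_recursion Γ.geom ρ hAdm (channelSizeNN_of_perStepNN hres hsum hstep) hfac hKP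
    (Γ.decayExtract hd₁) (Γ.pinBudget ha₁ hκ hκd) hexpl hbase (fun j => hNsucc j) hNnn
    (fun k P hP => mem_boxSet.2 (hbox k P hP))
  exact ⟨h.1, fun g hg g' hg' k x => mem_boxSet.1 (h.2 g hg g' hg' k) x⟩

/-- **NE9 ∧ FADING MEMORY ON A CUBE CHART WITH THE OCCUPATION DERIVED (kernel end-to-end, v1.2).**  §7b's
`cubeChart_ne9_and_fadingMemory_of_boxMajorant` with its occupation hypothesis `hocc` («occurring tables lie in the box β k»,
the residual (iv) of GAPS G-ne9p2-5: a HISTORY-UNIFORM bound of TYPE (1.36)/(I.1.18) on the hybrid tables, displayed)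
REPLACED by the size-induction data of `cubeChart_termSize_and_boxOcc`: (B0) base size at scale 0, (X) the
table-independent part of the new term `≤ e^{−κd}·p₀ k` uniformly on the window, (N) a nonnegative profile with
`p₀ j + a₁ ≤ N (j+1)` (print, [II] p. 21: `O(1)C₃ε₁ ≦ ½E₀` plus the absolute constant `½E₀`), (R′) the read-out of the
weighted output box of radius `sizeRadius τ N k` into the box `β k`.  Same moduli `ℓ·∏(ω + 4·lipbar·a₁·τ̄)`, fading iff
`ω + 4·lipbar·a₁·τ̄ < 1`.  DISPLAYED and unchanged: `ScaleZeroFree`, the channel binders (reading G-ne9p2-4),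
`LastCouplingLipschitz` (NE9-LAST, wall (L)), the read-out's weighted-Lipschitz law `hρ`, the cluster-sum factorisation `hΨ`,
the activity side (L′)/(A″) and the scalar smallness (C).  Nothing of [I]–[III] asserted; rung (B)+1 bookkeeping on a fixed
finite torus. [cite: Balaban1988RG2Cluster, (1.36) p.9, (2.15) p.15, (2.18)-(2.20) p.16, (2.23)-(2.26) p.17, Lemma 3 (2.38) p.20, (2.41) p.21 and p.21 text; Balaban1987RG1, (0.23) p.256, (1.18) p.263; KoteckyPreiss1986, (1)-(3)] -/
theorem cubeChart_ne9_and_fadingMemory_of_sizeInduction (Γ : CubeChart C α adj D) {ι : Type} {E : Functional C Bg}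
    {W : Set (ℕ → ℝ)} {Adm : Set (Bg → C.Dom → ℝ)} {T : ℕ → (ℕ → ℝ) → (Bg → C.Dom → ℝ) → ι → ℝ}
    {Ψ : ℕ → ℝ → (ι → ℝ) → Bg → C.Dom → ℝ}
    {μ : ℕ → ℝ → Bg → Finset α → Measure Ω} {pre : ℕ → ℝ → Bg → Finset α → Ω → ℂ}
    {c : ℕ → ℝ → Bg → Finset α → Ω → F → ℂ} {pt : ℕ → ℝ → Bg → Finset α → Ω → F → Sp} {β : ℕ → Sp → ℝ}
    {lip ε : ℕ → ℝ} {y a₁ d₁ θ κ lipbar ℓ τbar ω : ℝ} {wt : ℕ → ι → ℝ} {τ : ℕ → ℕ → ℝ} {lam p₀ N : ℕ → ℝ}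
    (ρ : ℕ → (ι → ℝ) → (Sp →ᵇ ℂ))
    -- recursion side (displayed, named binders of the sibling leaves)
    (h0 : ScaleZeroFree E W) (hAdm : AdmissibleTerms E W Adm) (hres : AdmRestrict Adm)
    (hadd : ChannelAdditive Adm T) (hsum : ChannelStepSum Adm T) (hstep : ChannelSizeAtStepNN Adm T κ wt τ)
    (hfac : Factorises E W T Ψ) (hlast : LastCouplingLipschitz E W T Ψ κ lam)
    (hρ : ∀ (k : ℕ) (P P' : ι → ℝ) (M : ℝ), (∀ y, |P y - P' y| ≤ wt k y * M) → ‖ρ k P - ρ k P'‖ ≤ M)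
    (hΨ : ∀ (k : ℕ) (s : ℝ) (P P' : ι → ℝ) (U : Bg) (X : C.Dom),
      Ψ k s P U X - Ψ k s P' U X =
        (Γ.geom.newTerm (Γ.geom.avgExpLinearAct μ pre fun k s U γ ω => evalFunctional (c k s U γ ω) (pt k s U γ ω))
            k s U X (ρ k P) -
          Γ.geom.newTerm (Γ.geom.avgExpLinearAct μ pre fun k s U γ ω => evalFunctional (c k s U γ ω) (pt k s U γ ω))
            k s U X (ρ k P')).re)
    -- the size-induction data (B0), (X), (N), (R′) — in place of the occupation hypothesis of §7/§7b
    (hexpl : ∀ g ∈ W, ∀ (k : ℕ) (P : ι → ℝ) (U : Bg) (X : C.Dom), C.scale X = k + 1 →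
      |Ψ k (g k) P U X -
          (Γ.geom.newTerm (Γ.geom.avgExpLinearAct μ pre fun k s U γ ω => evalFunctional (c k s U γ ω) (pt k s U γ ω))
            k (g k) U X (ρ k P)).re| ≤ Real.exp (-(κ * C.d X)) * p₀ k)
    (hbase : ∀ g ∈ W, ∀ (U : Bg) (X : C.Dom), C.scale X = 0 → |E g U X| ≤ Real.exp (-(κ * C.d X)) * N 0)
    (hNsucc : ∀ j, p₀ j + a₁ ≤ N (j + 1)) (hNnn : ∀ j, 0 ≤ N j)
    (hbox : ∀ (k : ℕ) (P : ι → ℝ), (∀ y, |P y| ≤ wt k y * sizeRadius τ N k) → ∀ x, ‖ρ k P x‖ ≤ β k x)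
    -- activity side: regularity data, scales, ONE integrability (TYPE (2.23)-(2.25)), (L′) scale bound, (A″) box-majorant decay
    (hpre : ∀ k s U γ, AEStronglyMeasurable (pre k s U γ) (μ k s U γ))
    (hc : ∀ k s U γ Y, AEStronglyMeasurable (fun ω => c k s U γ ω Y) (μ k s U γ))
    (hpt : ∀ k s U γ Y, Measurable fun ω => pt k s U γ ω Y) (hlip : ∀ k, 0 < lip k) (hlipb : ∀ k, lip k ≤ lipbar)
    (hint₀ : ∀ k s U γ, Integrable (fun ω => ‖pre k s U γ ω‖ * Real.exp (boxExponent c pt β k s U γ ω)) (μ k s U γ))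
    (hL : ∀ k s U (γ : Finset α) ω, coeffSum c k s U γ ω ≤ lip k * (γ.card : ℝ))
    (hε : ∀ k, 0 ≤ ε k) (hy : 0 ≤ y)
    (hdecay₀ : ∀ g ∈ W, ∀ (k : ℕ) (U : Bg) (X : C.Dom), C.scale X = k + 1 → ∀ γ' ∈ Γ.vol X,
      ∫ ω, ‖pre k (g k) U γ' ω‖ * Real.exp (boxExponent c pt β k (g k) U γ' ω) ∂(μ k (g k) U γ') ≤ ε k * y ^ γ'.card)
    -- (C) scalar smallness (decay base 2y) and the envelope data
    (hθ : 2 * y * Real.exp (a₁ + d₁) * Real.exp (D * θ) ≤ θ) (hεθ : ∀ k, 2 * ε k * θ * ((D : ℝ) + 1) ≤ a₁)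
    (ha₁ : 0 ≤ a₁) (hκ : 0 ≤ κ) (hκd : κ ≤ d₁) (hℓ : 0 ≤ ℓ) (hτbar : 0 ≤ τbar) (hω : 0 ≤ ω)
    (hpos : 0 < ω + 4 * lipbar * a₁ * τbar) (hlam : ∀ k, lam k ≤ ℓ)
    (hτ : ∀ k j, j ≤ k → 0 ≤ τ k j ∧ τ k j ≤ τbar * ω ^ (k - j)) :
    NE9 E W κ (prodModuli ℓ fun _ => ω + 4 * lipbar * a₁ * τbar) ∧
      FadingMemory (ℓ / (ω + 4 * lipbar * a₁ * τbar)) (ω + 4 * lipbar * a₁ * τbar)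
        (prodModuli ℓ fun _ => ω + 4 * lipbar * a₁ * τbar) :=
  have hocc := (cubeChart_termSize_and_boxOcc Γ ρ hAdm hres hsum hstep hfac hexpl hbase hNsucc hNnn hbox hpre hc hpt hlip
    hint₀ hL hε hy hdecay₀ hθ hεθ ha₁ hκ hκd).2
  cubeChart_ne9_and_fadingMemory_of_boxMajorant Γ ρ h0 hAdm hres hadd hsum hstep hfac hlast hρ hΨ hocc hpre hc hpt hlip
    hlipb hint₀ hL hε hy hdecay₀ hθ hεθ ha₁ hκ hκd hℓ hτbar hω hpos hlam hτ

end EndToEndSizeInduction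

/-! ## §10 NON-VACUITY of §9 on the nonlinear toy recursion: the occupation `|tables| ≤ 3/2` of
`T4HistoryLipschitzActivity.kpToy_occ` RE-DERIVED by the abstract size induction (`3/2 = ½ + 1·1`) -/

section ToySize

/-- the diagonal weights of the toy channel generate the radius `N k`. [folklore] -/
theorem sizeRadius_diag (N : ℕ → ℝ) (k : ℕ) : sizeRadius (fun k j => if j = k then 1 else 0) N k = N k := by
  unfold sizeRadius
  rw [Finset.sum_eq_single k]
  · simp
  · intro j _ hj
    simp [hj]
  · intro hk
    exact absurd (Finset.mem_range.mpr (Nat.lt_succ_self k)) hk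

/-- **THE SIZE INDUCTION ON THE TOY (non-vacuity of §9 with every binder inhabited and the constants computed)**: for
`0 ≤ μ`, `6μe ≤ 1` and a window of histories with `|g_i| ≤ ½`, `termSize_of_recursion` — fed with the toy's admissible
class (all functionals), the diagonal channel weights of `T4HistoryLipschitzRecursion.toy_perStep` (`wt ≡ 1`,
`τ k j = [j = k]`), the factorisation `kpToy_factorises`, TWO-POINT KP `kpToy_twoPointKP` on the discs `‖Q‖ ≤ 3/2`,
`kpToy_decayExtract`, `kpToy_pinBudget` (`B₀ ≡ 1`, κ = 0), the table-independent part `g_k` (`p₀ ≡ ½`), base size `0`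
and the profile `N 0 = 0`, `N (j+1) = 3/2 = ½ + 1` — returns the size bound `|E_k| ≤ 3/2` for every history AND the
occupation `‖read (channel output)‖ ≤ 3/2` of `T4HistoryLipschitzActivity.kpToy_occ`, there proved by hand. [folklore] -/
theorem kpToy_termSize {μ : ℝ} (hμ : 0 ≤ μ) (hμ1 : 6 * μ * Real.exp 1 ≤ 1) {W : Set (ℕ → ℝ)}
    (hW : ∀ g ∈ W, ∀ i, |g i| ≤ 1 / 2) :
    TermSize (C := toyCarriers) (kpToyE μ) W 0 (fun n => if n = 0 then 0 else 3 / 2) ∧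
      ∀ g ∈ W, ∀ g' ∈ W, ∀ k : ℕ, kpToyRead k (toyChannel k g' (kpToyE μ g)) ∈ closedBall (0 : ℂ) (3 / 2) := by
  have hAdm : AdmissibleTerms (C := toyCarriers) (kpToyE μ) W Set.univ :=
    ⟨fun _ _ => Set.mem_univ _, fun _ _ _ _ => Set.mem_univ _⟩
  have hsize := channelSizeNN_of_perStepNN toy_perStep.1 toy_perStep.2.1
    (channelSizeAtStepNN_of_channelSizeAtStep toy_perStep.2.2)
  refine termSize_of_recursion kpToyGeom kpToyRead (p₀ := fun _ => 1 / 2) hAdm hsize (kpToy_factorises μ W)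
    (kpToy_twoPointKP hμ hμ1 W) kpToy_decayExtract kpToy_pinBudget ?_ ?_ ?_ ?_ ?_
  · -- (X): the table-independent part of the toy new term is the last coupling itself
    intro g hg k P u X _
    have h : kpToyΨ μ k (g k) P u X - (kpToyGeom.newTerm (kpToyAct μ) k (g k) u X (kpToyRead k P)).re = g k := by
      simp only [kpToyΨ, kpToyRead]
      ring
    rw [h]
    simpa using hW g hg k
  · -- (B0): nothing is created at step 0
    intro g _ u X hX
    change X = 0 at hX
    subst hX
    simp [kpToyE, kpToySeq]
  · -- (N): ½ + 1 ≤ 3/2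
    intro j
    simp only [Nat.succ_ne_zero, if_false]
    norm_num
  · intro j
    split_ifs <;> norm_num
  · -- (R′): the read-out of the weighted output box of radius N k lies in the disc of radius 3/2
    intro k P hP
    rw [mem_closedBall_zero_iff]
    have h := hP ()
    rw [sizeRadius_diag, one_mul] at h
    simp only [kpToyRead, Complex.norm_real, Real.norm_eq_abs]
    refine h.trans ?_
    split_ifs <;> norm_num

end ToySize

/-! ## §11 (v1.3) THE PINNED FORM (L″) OF THE SCALE BOUND: one inequality per cube of the polymer (TYPE (1.26) p. 8,
the resummation after (2.19) p. 16 of [II]) implies (L′) by double counting; end-to-end with `hL` replaced -/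

section Pinned

/-- **DOUBLE COUNTING OVER CUBES (kernel)**: nonnegative weights `w Y` of domains, each contributing domain meeting the
polymer `γ` (`dom Y ∩ γ ≠ ∅`), with the PINNED sums `Σ_{Y : x ∈ dom Y} w Y ≤ L` at every cube `x ∈ γ`, have total
`Σ_Y w Y ≤ L·#γ` — the counting behind the last term of (2.20) p. 16 of [II]. [folklore] -/
theorem sum_le_mul_card_of_pinned {F α : Type*} [Fintype F] [DecidableEq α] {w : F → ℝ} {dom : F → Finset α}
    {γ : Finset α} {L : ℝ} (hw : ∀ Y, 0 ≤ w Y) (hmeet : ∀ Y, w Y ≠ 0 → ∃ x ∈ γ, x ∈ dom Y)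
    (hpin : ∀ x ∈ γ, ∑ Y ∈ Finset.univ.filter (fun Y => x ∈ dom Y), w Y ≤ L) :
    ∑ Y, w Y ≤ L * (γ.card : ℝ) := by
  classical
  calc ∑ Y, w Y ≤ ∑ Y, ∑ x ∈ γ, (if x ∈ dom Y then w Y else 0) := by
        refine Finset.sum_le_sum fun Y _ => ?_
        by_cases h0 : w Y = 0
        · calc w Y = 0 := h0
            _ ≤ ∑ x ∈ γ, (if x ∈ dom Y then w Y else 0) :=
                Finset.sum_nonneg fun x _ => ite_nonneg (hw Y) le_rfl
        · obtain ⟨x, hxγ, hxY⟩ := hmeet Y h0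
          calc w Y = (if x ∈ dom Y then w Y else 0) := by rw [if_pos hxY]
            _ ≤ ∑ x ∈ γ, (if x ∈ dom Y then w Y else 0) :=
                Finset.single_le_sum (f := fun x => if x ∈ dom Y then w Y else 0)
                  (fun x _ => ite_nonneg (hw Y) le_rfl) hxγ
    _ = ∑ x ∈ γ, ∑ Y, (if x ∈ dom Y then w Y else 0) := Finset.sum_comm
    _ = ∑ x ∈ γ, ∑ Y ∈ Finset.univ.filter (fun Y => x ∈ dom Y), w Y :=
        Finset.sum_congr rfl fun x _ => by rw [Finset.sum_filter]
    _ ≤ ∑ x ∈ γ, L := Finset.sum_le_sum hpin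
    _ = L * (γ.card : ℝ) := by rw [Finset.sum_const, nsmul_eq_mul, mul_comm]

variable {Bg : Type} {Ω : Type*} {F : Type*} [Fintype F] {α : Type} [DecidableEq α]

/-- **(L″) ⇒ (L′) (kernel)**: PINNED coefficient sums `Σ_{Y : x ∈ dom Y} ‖c_ω(Y)‖ ≤ lip k` at every cube of the polymer,
for coefficients supported on domains meeting the polymer, give the scale bound `coeffSum ≤ lip k·#cubes` of §7b (L′).
TYPE of the hypothesis: [II] (1.26) p. 8 («Σ_{X∈𝐃_j,X⊃□′} exp(−κd_j(X)) ≦ O(1)»), p. 16 after (2.19). [cite: Balaban1988RG2Cluster, (1.26) p.8, (2.19)-(2.20) p.16] -/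
theorem coeffSum_le_of_pinned {c : ℕ → ℝ → Bg → Finset α → Ω → F → ℂ} {dom : ℕ → Finset α → F → Finset α}
    {lip : ℕ → ℝ} (hmeet : ∀ k s U (γ : Finset α) ω Y, c k s U γ ω Y ≠ 0 → ∃ x ∈ γ, x ∈ dom k γ Y)
    (hpin : ∀ k s U (γ : Finset α) ω, ∀ x ∈ γ,
      ∑ Y ∈ Finset.univ.filter (fun Y => x ∈ dom k γ Y), ‖c k s U γ ω Y‖ ≤ lip k) :
    ∀ k s U (γ : Finset α) ω, coeffSum c k s U γ ω ≤ lip k * (γ.card : ℝ) :=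
  fun k s U γ ω => sum_le_mul_card_of_pinned (w := fun Y => ‖c k s U γ ω Y‖) (fun _ => norm_nonneg _)
    (fun Y hY => hmeet k s U γ ω Y fun h => hY (by simp only [h, norm_zero])) (hpin k s U γ ω)

end Pinned

section EndToEndPinned

open BoundedContinuousFunction

variable {C : Carriers} {α : Type} [DecidableEq α] {adj : α → α → Prop} [DecidableRel adj] [Std.Symm adj] {D : ℕ}
variable {Bg : Type} {Sp : Type*} [TopologicalSpace Sp] [MeasurableSpace Sp] [OpensMeasurableSpace Sp] {F : Type*}
  [Fintype F] {Ω : Type*} [MeasurableSpace Ω]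

/-- **NE9 ∧ FADING MEMORY ON A CUBE CHART, PINNED SCALE BOUND (kernel end-to-end, v1.3).**  §9b's
`cubeChart_ne9_and_fadingMemory_of_sizeInduction` with the scale bound (L′) `coeffSum ≤ lip k·#cubes` REPLACED by its PINNED
form (L″): a domain map `dom k γ : F → Finset α`, the support condition `hmeet` (a nonzero coefficient sits on a domain meeting
the polymer — TYPE: [II] p. 17 «𝐃_i satisfy ∪_{Y∈𝐃_i} Y = Y_i») and `hpin` (at every cube of the polymer the coefficients of
the domains containing it sum to `≤ lip k` — TYPE: the pinned sums (1.26) p. 8 / the resummation after (2.19) p. 16, whose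
total is the last term of (2.20)).  Everything else as in §9b, same conclusion.  (L″) is displayed, not asserted; nothing of
[I]–[III] asserted; rung (B)+1 bookkeeping. [cite: Balaban1988RG2Cluster, (1.26) p.8, (2.19)-(2.20) p.16, p.17 text, (2.41) p.21; Balaban1987RG1, (0.23) p.256, (1.18) p.263; KoteckyPreiss1986, (1)-(3)] -/
theorem cubeChart_ne9_and_fadingMemory_of_pinned (Γ : CubeChart C α adj D) {ι : Type} {E : Functional C Bg}
    {W : Set (ℕ → ℝ)} {Adm : Set (Bg → C.Dom → ℝ)} {T : ℕ → (ℕ → ℝ) → (Bg → C.Dom → ℝ) → ι → ℝ}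
    {Ψ : ℕ → ℝ → (ι → ℝ) → Bg → C.Dom → ℝ}
    {μ : ℕ → ℝ → Bg → Finset α → Measure Ω} {pre : ℕ → ℝ → Bg → Finset α → Ω → ℂ}
    {c : ℕ → ℝ → Bg → Finset α → Ω → F → ℂ} {pt : ℕ → ℝ → Bg → Finset α → Ω → F → Sp} {β : ℕ → Sp → ℝ}
    {dom : ℕ → Finset α → F → Finset α}
    {lip ε : ℕ → ℝ} {y a₁ d₁ θ κ lipbar ℓ τbar ω : ℝ} {wt : ℕ → ι → ℝ} {τ : ℕ → ℕ → ℝ} {lam p₀ N : ℕ → ℝ}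
    (ρ : ℕ → (ι → ℝ) → (Sp →ᵇ ℂ))
    (h0 : ScaleZeroFree E W) (hAdm : AdmissibleTerms E W Adm) (hres : AdmRestrict Adm)
    (hadd : ChannelAdditive Adm T) (hsum : ChannelStepSum Adm T) (hstep : ChannelSizeAtStepNN Adm T κ wt τ)
    (hfac : Factorises E W T Ψ) (hlast : LastCouplingLipschitz E W T Ψ κ lam)
    (hρ : ∀ (k : ℕ) (P P' : ι → ℝ) (M : ℝ), (∀ y, |P y - P' y| ≤ wt k y * M) → ‖ρ k P - ρ k P'‖ ≤ M)
    (hΨ : ∀ (k : ℕ) (s : ℝ) (P P' : ι → ℝ) (U : Bg) (X : C.Dom),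
      Ψ k s P U X - Ψ k s P' U X =
        (Γ.geom.newTerm (Γ.geom.avgExpLinearAct μ pre fun k s U γ ω => evalFunctional (c k s U γ ω) (pt k s U γ ω))
            k s U X (ρ k P) -
          Γ.geom.newTerm (Γ.geom.avgExpLinearAct μ pre fun k s U γ ω => evalFunctional (c k s U γ ω) (pt k s U γ ω))
            k s U X (ρ k P')).re)
    (hexpl : ∀ g ∈ W, ∀ (k : ℕ) (P : ι → ℝ) (U : Bg) (X : C.Dom), C.scale X = k + 1 →
      |Ψ k (g k) P U X -
          (Γ.geom.newTerm (Γ.geom.avgExpLinearAct μ pre fun k s U γ ω => evalFunctional (c k s U γ ω) (pt k s U γ ω))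
            k (g k) U X (ρ k P)).re| ≤ Real.exp (-(κ * C.d X)) * p₀ k)
    (hbase : ∀ g ∈ W, ∀ (U : Bg) (X : C.Dom), C.scale X = 0 → |E g U X| ≤ Real.exp (-(κ * C.d X)) * N 0)
    (hNsucc : ∀ j, p₀ j + a₁ ≤ N (j + 1)) (hNnn : ∀ j, 0 ≤ N j)
    (hbox : ∀ (k : ℕ) (P : ι → ℝ), (∀ y, |P y| ≤ wt k y * sizeRadius τ N k) → ∀ x, ‖ρ k P x‖ ≤ β k x)
    (hpre : ∀ k s U γ, AEStronglyMeasurable (pre k s U γ) (μ k s U γ))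
    (hc : ∀ k s U γ Y, AEStronglyMeasurable (fun ω => c k s U γ ω Y) (μ k s U γ))
    (hpt : ∀ k s U γ Y, Measurable fun ω => pt k s U γ ω Y) (hlip : ∀ k, 0 < lip k) (hlipb : ∀ k, lip k ≤ lipbar)
    (hint₀ : ∀ k s U γ, Integrable (fun ω => ‖pre k s U γ ω‖ * Real.exp (boxExponent c pt β k s U γ ω)) (μ k s U γ))
    -- (L″) PINNED scale bound: coefficients live on domains meeting the polymer; pinned sums ≤ lip k at every cube
    (hmeet : ∀ k s U (γ : Finset α) ω Y, c k s U γ ω Y ≠ 0 → ∃ x ∈ γ, x ∈ dom k γ Y)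
    (hpin : ∀ k s U (γ : Finset α) ω, ∀ x ∈ γ,
      ∑ Y ∈ Finset.univ.filter (fun Y => x ∈ dom k γ Y), ‖c k s U γ ω Y‖ ≤ lip k)
    (hε : ∀ k, 0 ≤ ε k) (hy : 0 ≤ y)
    (hdecay₀ : ∀ g ∈ W, ∀ (k : ℕ) (U : Bg) (X : C.Dom), C.scale X = k + 1 → ∀ γ' ∈ Γ.vol X,
      ∫ ω, ‖pre k (g k) U γ' ω‖ * Real.exp (boxExponent c pt β k (g k) U γ' ω) ∂(μ k (g k) U γ') ≤ ε k * y ^ γ'.card)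
    (hθ : 2 * y * Real.exp (a₁ + d₁) * Real.exp (D * θ) ≤ θ) (hεθ : ∀ k, 2 * ε k * θ * ((D : ℝ) + 1) ≤ a₁)
    (ha₁ : 0 ≤ a₁) (hκ : 0 ≤ κ) (hκd : κ ≤ d₁) (hℓ : 0 ≤ ℓ) (hτbar : 0 ≤ τbar) (hω : 0 ≤ ω)
    (hpos : 0 < ω + 4 * lipbar * a₁ * τbar) (hlam : ∀ k, lam k ≤ ℓ)
    (hτ : ∀ k j, j ≤ k → 0 ≤ τ k j ∧ τ k j ≤ τbar * ω ^ (k - j)) :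
    NE9 E W κ (prodModuli ℓ fun _ => ω + 4 * lipbar * a₁ * τbar) ∧
      FadingMemory (ℓ / (ω + 4 * lipbar * a₁ * τbar)) (ω + 4 * lipbar * a₁ * τbar)
        (prodModuli ℓ fun _ => ω + 4 * lipbar * a₁ * τbar) :=
  cubeChart_ne9_and_fadingMemory_of_sizeInduction Γ ρ h0 hAdm hres hadd hsum hstep hfac hlast hρ hΨ hexpl hbase hNsucc hNnn
    hbox hpre hc hpt hlip hlipb hint₀ (coeffSum_le_of_pinned hmeet hpin) hε hy hdecay₀ hθ hεθ ha₁ hκ hκd hℓ hτbar hω hpos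
    hlam hτ

end EndToEndPinned

/-! ## §12 (v1.4) THE PINNED COMBINATORIAL SUM (1.26) PROVED on the abstract cube set: (L″) from PER-DOMAIN DECAY (L‴),
connectedness of the domains and the lattice-animal entropy bound; end-to-end with `hpin` replaced -/

section DomainDecay

variable {F : Type*} [Fintype F] {α : Type*} [DecidableEq α] {adj : α → α → Prop} [DecidableRel adj] [Std.Symm adj]

/-- **THE PINNED SUM (1.26) / the middle inequality of (0.26) (kernel, abstract cube set).**  Weights `w Y ≤ αc·y₁^{#dom Y}`
indexed by a finite type, every NONEMPTY domain CONNECTED for an adjacency of degree `≤ D` (rooted reachability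
`Polymer.IsConn`), the domain map INJECTIVE on the nonempty domains, and the smallness `y₁·e^{D·θ₁} ≤ θ₁`: at every cube `x`,
`Σ_{Y : x ∈ dom Y} w Y ≤ αc·θ₁`.  Proof: the domains through `x` inject into the connected cube families rooted at `x` inside
the finite union of all domains, and the tree's lattice-animal bound `Polymer.sum_isConn_pow_card_le` (∘
`T4HistoryLipschitzEntropy.sum_isConn_mul_pow_card_le`).  TYPE: [II] (1.26) p. 8 «Σ_{X∈𝐃_j,X⊃□′} exp(−κd_j(X)) ≦ O(1),» —
«This inequality was used many times in convergence proofs for cluster expansions, for example see [48, 50, 40, 26, 3].» —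
and [I] (0.26) p. 257, with decay in the NUMBER OF CUBES in place of `exp(−κd_j(X))` ([II] (2.30) p. 18 «(3·2³)⁻¹M⁻⁴|Y| ≦
d_k(Y)», «holding for localization domains Y∈𝐃_k»).  Here it is a theorem, not a hypothesis shape.
[cite: FriedliVelenik2017, Lemma 3.38; Balaban1988RG2Cluster, (1.26) p.8, (2.30) p.18; Balaban1987RG1, (0.26) p.257] -/
theorem pinnedSum_le_of_domainDecay (D : ℕ) (hD : ∀ (a : α) (Q : Finset α), (Q.filter (adj a)).card ≤ D)
    {w : F → ℝ} {dom : F → Finset α} {αc y₁ θ₁ : ℝ} (hαc : 0 ≤ αc) (hy₁ : 0 ≤ y₁)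
    (hθ₁ : y₁ * Real.exp (D * θ₁) ≤ θ₁) (hw : ∀ Y, w Y ≤ αc * y₁ ^ (dom Y).card)
    (hconn : ∀ Y, (dom Y).Nonempty → ∃ a ∈ dom Y, Polymer.IsConn adj (dom Y) a)
    (hinj : Set.InjOn dom {Y | (dom Y).Nonempty}) (x : α) :
    ∑ Y ∈ Finset.univ.filter (fun Y => x ∈ dom Y), w Y ≤ αc * θ₁ := by
  classical
  calc ∑ Y ∈ Finset.univ.filter (fun Y => x ∈ dom Y), w Y
      ≤ ∑ Y ∈ Finset.univ.filter (fun Y => x ∈ dom Y), αc * y₁ ^ (dom Y).card :=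
        Finset.sum_le_sum fun Y _ => hw Y
    _ = ∑ X ∈ (Finset.univ.filter (fun Y => x ∈ dom Y)).image dom, αc * y₁ ^ X.card := by
        rw [Finset.sum_image]
        exact fun Y₁ h₁ Y₂ h₂ he => hinj ⟨x, (Finset.mem_filter.1 h₁).2⟩ ⟨x, (Finset.mem_filter.1 h₂).2⟩ he
    _ ≤ ∑ X ∈ (Finset.univ.biUnion dom).powerset.filter (fun X => Polymer.IsConn adj X x), αc * y₁ ^ X.card := by
        refine Finset.sum_le_sum_of_subset_of_nonneg ?_ fun X _ _ => mul_nonneg hαc (pow_nonneg hy₁ _)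
        intro X hX
        obtain ⟨Y, hY, rfl⟩ := Finset.mem_image.1 hX
        have hxY : x ∈ dom Y := (Finset.mem_filter.1 hY).2
        obtain ⟨a, _, hca⟩ := hconn Y ⟨x, hxY⟩
        exact Finset.mem_filter.2 ⟨Finset.mem_powerset.2 (Finset.subset_biUnion_of_mem dom (Finset.mem_univ Y)),
          isConn_reroot hca hxY⟩
    _ ≤ αc * θ₁ := sum_isConn_mul_pow_card_le D hD hαc hy₁ hθ₁ (Finset.univ.biUnion dom) x

/-- **(1.26) ON THE LOCALIZATION DOMAINS OF A REGION (kernel)**: for the chart's own localization domains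
`connFamilies adj R` (the connected nonempty cube families inside a finite region, [I] p. 257) of an adjacency of degree
`≤ D` and `y₁·e^{D·θ₁} ≤ θ₁`: at every cube `x`, `Σ_{Y ∈ connFamilies adj R, x ∈ Y} y₁^{#Y} ≤ θ₁` — the literal shape of
[II] (1.26) p. 8 / [I] (0.26) p. 257 with `exp(−κd_j(X))` ↦ `y₁^{#cubes(X)}` ((2.30) p. 18).
[cite: FriedliVelenik2017, Lemma 3.38; Balaban1988RG2Cluster, (1.26) p.8; Balaban1987RG1, (0.26) p.257] -/
theorem sum_connFamilies_pinned_le (D : ℕ) (hD : ∀ (a : α) (Q : Finset α), (Q.filter (adj a)).card ≤ D) {y₁ θ₁ : ℝ}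
    (hy₁ : 0 ≤ y₁) (hθ₁ : y₁ * Real.exp (D * θ₁) ≤ θ₁) (R : Finset α) (x : α) :
    ∑ Y ∈ (connFamilies adj R).filter (fun Y => x ∈ Y), y₁ ^ Y.card ≤ θ₁ := by
  classical
  calc ∑ Y ∈ (connFamilies adj R).filter (fun Y => x ∈ Y), y₁ ^ Y.card
      ≤ ∑ X ∈ R.powerset.filter (fun X => Polymer.IsConn adj X x), y₁ ^ X.card := by
        refine Finset.sum_le_sum_of_subset_of_nonneg ?_ fun X _ _ => pow_nonneg hy₁ _
        intro Y hY
        obtain ⟨hYc, hxY⟩ := Finset.mem_filter.1 hY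
        obtain ⟨hsub, a, _, hca⟩ := mem_connFamilies.1 hYc
        exact Finset.mem_filter.2 ⟨Finset.mem_powerset.2 hsub, isConn_reroot hca hxY⟩
    _ ≤ θ₁ := Polymer.sum_isConn_pow_card_le D hD hy₁ hθ₁ R x

/-- **(1.26) ON THE DISCRETE TORUS (kernel instance)**: for cube families of one scale on `Fin ν → ZMod N` with the wall
adjacency (degree `≤ 2ν`, `= 8` on T⁴): `Σ_{Y ∈ connFamilies (torusAdj ν N) R, x ∈ Y} y₁^{#Y} ≤ θ₁` whenever
`y₁·e^{2ν·θ₁} ≤ θ₁`. [cite: FriedliVelenik2017, Lemma 3.38; Balaban1988RG2Cluster, (1.26) p.8] -/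
theorem torus_sum_connFamilies_pinned_le (ν N : ℕ) {y₁ θ₁ : ℝ} (hy₁ : 0 ≤ y₁)
    (hθ₁ : y₁ * Real.exp ((2 * ν : ℕ) * θ₁) ≤ θ₁) (R : Finset (Fin ν → ZMod N)) (x : Fin ν → ZMod N) :
    ∑ Y ∈ (connFamilies (torusAdj ν N) R).filter (fun Y => x ∈ Y), y₁ ^ Y.card ≤ θ₁ :=
  sum_connFamilies_pinned_le (2 * ν) (card_filter_torusAdj_le ν N) hy₁ hθ₁ R x

variable {Bg : Type} {Ω : Type*}

/-- **(L‴) ⇒ (L″) (kernel)**: PER-DOMAIN DECAY of the coefficient tables `‖c_ω(Y)‖ ≤ αc k·y₁^{#dom Y}` (TYPE: the summand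
«+ Σ_{Y∈𝐃} α₄ exp(−δκd_k(Y))» of [II] (2.20) p. 16 = radius (2.18) «1/|τ(Y)| = E₀ε₁C₁α₄^{−1}M^q exp C₂κ₁ exp(−(1 −
3δ)κd_k(Y))» × table size (1.36) p. 9, with (2.30) p. 18 converting decay in `d_k` into decay in the number of cubes),
connectedness of every nonempty domain (TYPE [I] p. 257), injectivity of the domain labelling on nonempty domains, degree
`≤ D` and `y₁·e^{D·θ₁} ≤ θ₁`, `αc k·θ₁ ≤ lip k` GIVE the pinned scale bound (L″) of §11 at every cube (of the polymer or not).
The radii and the normalisation of the table coordinates are the instantiator's; (L‴) is displayed, not asserted.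
[cite: Balaban1988RG2Cluster, (2.18)-(2.20) p.16, (1.36) p.9, (2.30) p.18, (1.26) p.8; Balaban1987RG1, p.257; FriedliVelenik2017, Lemma 3.38] -/
theorem pin_of_domainDecay (D : ℕ) (hD : ∀ (a : α) (Q : Finset α), (Q.filter (adj a)).card ≤ D)
    {c : ℕ → ℝ → Bg → Finset α → Ω → F → ℂ} {dom : ℕ → Finset α → F → Finset α} {αc lip : ℕ → ℝ} {y₁ θ₁ : ℝ}
    (hαc : ∀ k, 0 ≤ αc k) (hy₁ : 0 ≤ y₁) (hθ₁ : y₁ * Real.exp (D * θ₁) ≤ θ₁) (hliplb : ∀ k, αc k * θ₁ ≤ lip k)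
    (hcdec : ∀ k s U (γ : Finset α) ω Y, ‖c k s U γ ω Y‖ ≤ αc k * y₁ ^ (dom k γ Y).card)
    (hdomconn : ∀ k (γ : Finset α) Y, (dom k γ Y).Nonempty → ∃ a ∈ dom k γ Y, Polymer.IsConn adj (dom k γ Y) a)
    (hdominj : ∀ k (γ : Finset α), Set.InjOn (dom k γ) {Y | (dom k γ Y).Nonempty}) :
    ∀ k s U (γ : Finset α) ω, ∀ x ∈ γ,
      ∑ Y ∈ Finset.univ.filter (fun Y => x ∈ dom k γ Y), ‖c k s U γ ω Y‖ ≤ lip k :=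
  fun k s U γ ω x _ =>
    (pinnedSum_le_of_domainDecay D hD (hαc k) hy₁ hθ₁ (hcdec k s U γ ω) (hdomconn k γ) (hdominj k γ) x).trans (hliplb k)

end DomainDecay

section EndToEndDomainDecay

open BoundedContinuousFunction

variable {C : Carriers} {α : Type} [DecidableEq α] {adj : α → α → Prop} [DecidableRel adj] [Std.Symm adj] {D : ℕ}
variable {Bg : Type} {Sp : Type*} [TopologicalSpace Sp] [MeasurableSpace Sp] [OpensMeasurableSpace Sp] {F : Type*}
  [Fintype F] {Ω : Type*} [MeasurableSpace Ω]

/-- **NE9 ∧ FADING MEMORY ON A CUBE CHART, PER-DOMAIN DECAY (kernel end-to-end, v1.4).**  §11's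
`cubeChart_ne9_and_fadingMemory_of_pinned` with the pinned scale bound (L″) `hpin` REPLACED by LOCAL print-typed data: (L‴)
per-domain decay of the coefficient tables `‖c_ω(Y)‖ ≤ αc k·y₁^{#dom Y}` (TYPE (2.18) × (1.36) = the summand of (2.20) p. 16,
+ (2.30) p. 18), connectedness of the nonempty domains ([I] p. 257), injectivity of the domain labelling, the smallness
`y₁·e^{D·θ₁} ≤ θ₁` for the chart's degree `D` and `αc k·θ₁ ≤ lip k` — the pinned sums (1.26) being now a THEOREM
(`pinnedSum_le_of_domainDecay`, via the chart's `deg`).  Everything else as in §11, same conclusion.  (L‴) is displayed, not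
asserted; nothing of [I]–[III] asserted; rung (B)+1 bookkeeping. [cite: Balaban1988RG2Cluster, (1.26) p.8, (2.18)-(2.20) p.16, p.17 text, (2.30) p.18, (2.41) p.21; Balaban1987RG1, (0.23) p.256, (0.26) p.257, (1.18) p.263; KoteckyPreiss1986, (1)-(3); FriedliVelenik2017, Lemma 3.38] -/
theorem cubeChart_ne9_and_fadingMemory_of_domainDecay (Γ : CubeChart C α adj D) {ι : Type} {E : Functional C Bg}
    {W : Set (ℕ → ℝ)} {Adm : Set (Bg → C.Dom → ℝ)} {T : ℕ → (ℕ → ℝ) → (Bg → C.Dom → ℝ) → ι → ℝ}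
    {Ψ : ℕ → ℝ → (ι → ℝ) → Bg → C.Dom → ℝ}
    {μ : ℕ → ℝ → Bg → Finset α → Measure Ω} {pre : ℕ → ℝ → Bg → Finset α → Ω → ℂ}
    {c : ℕ → ℝ → Bg → Finset α → Ω → F → ℂ} {pt : ℕ → ℝ → Bg → Finset α → Ω → F → Sp} {β : ℕ → Sp → ℝ}
    {dom : ℕ → Finset α → F → Finset α}
    {lip ε αc : ℕ → ℝ} {y a₁ d₁ θ κ lipbar ℓ τbar ω y₁ θ₁ : ℝ} {wt : ℕ → ι → ℝ} {τ : ℕ → ℕ → ℝ} {lam p₀ N : ℕ → ℝ}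
    (ρ : ℕ → (ι → ℝ) → (Sp →ᵇ ℂ))
    (h0 : ScaleZeroFree E W) (hAdm : AdmissibleTerms E W Adm) (hres : AdmRestrict Adm)
    (hadd : ChannelAdditive Adm T) (hsum : ChannelStepSum Adm T) (hstep : ChannelSizeAtStepNN Adm T κ wt τ)
    (hfac : Factorises E W T Ψ) (hlast : LastCouplingLipschitz E W T Ψ κ lam)
    (hρ : ∀ (k : ℕ) (P P' : ι → ℝ) (M : ℝ), (∀ y, |P y - P' y| ≤ wt k y * M) → ‖ρ k P - ρ k P'‖ ≤ M)
    (hΨ : ∀ (k : ℕ) (s : ℝ) (P P' : ι → ℝ) (U : Bg) (X : C.Dom),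
      Ψ k s P U X - Ψ k s P' U X =
        (Γ.geom.newTerm (Γ.geom.avgExpLinearAct μ pre fun k s U γ ω => evalFunctional (c k s U γ ω) (pt k s U γ ω))
            k s U X (ρ k P) -
          Γ.geom.newTerm (Γ.geom.avgExpLinearAct μ pre fun k s U γ ω => evalFunctional (c k s U γ ω) (pt k s U γ ω))
            k s U X (ρ k P')).re)
    (hexpl : ∀ g ∈ W, ∀ (k : ℕ) (P : ι → ℝ) (U : Bg) (X : C.Dom), C.scale X = k + 1 →
      |Ψ k (g k) P U X -
          (Γ.geom.newTerm (Γ.geom.avgExpLinearAct μ pre fun k s U γ ω => evalFunctional (c k s U γ ω) (pt k s U γ ω))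
            k (g k) U X (ρ k P)).re| ≤ Real.exp (-(κ * C.d X)) * p₀ k)
    (hbase : ∀ g ∈ W, ∀ (U : Bg) (X : C.Dom), C.scale X = 0 → |E g U X| ≤ Real.exp (-(κ * C.d X)) * N 0)
    (hNsucc : ∀ j, p₀ j + a₁ ≤ N (j + 1)) (hNnn : ∀ j, 0 ≤ N j)
    (hbox : ∀ (k : ℕ) (P : ι → ℝ), (∀ y, |P y| ≤ wt k y * sizeRadius τ N k) → ∀ x, ‖ρ k P x‖ ≤ β k x)
    (hpre : ∀ k s U γ, AEStronglyMeasurable (pre k s U γ) (μ k s U γ))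
    (hc : ∀ k s U γ Y, AEStronglyMeasurable (fun ω => c k s U γ ω Y) (μ k s U γ))
    (hpt : ∀ k s U γ Y, Measurable fun ω => pt k s U γ ω Y) (hlip : ∀ k, 0 < lip k) (hlipb : ∀ k, lip k ≤ lipbar)
    (hint₀ : ∀ k s U γ, Integrable (fun ω => ‖pre k s U γ ω‖ * Real.exp (boxExponent c pt β k s U γ ω)) (μ k s U γ))
    -- support: coefficients live on domains meeting the polymer (TYPE p. 17 «𝐃_i satisfy ∪_{Y∈𝐃_i} Y = Y_i»)
    (hmeet : ∀ k s U (γ : Finset α) ω Y, c k s U γ ω Y ≠ 0 → ∃ x ∈ γ, x ∈ dom k γ Y)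
    -- (L‴) PER-DOMAIN DECAY of the coefficients + connected, injectively labelled domains + entropy smallness
    (hαc : ∀ k, 0 ≤ αc k) (hy₁ : 0 ≤ y₁) (hθ₁ : y₁ * Real.exp (D * θ₁) ≤ θ₁) (hliplb : ∀ k, αc k * θ₁ ≤ lip k)
    (hcdec : ∀ k s U (γ : Finset α) ω Y, ‖c k s U γ ω Y‖ ≤ αc k * y₁ ^ (dom k γ Y).card)
    (hdomconn : ∀ k (γ : Finset α) Y, (dom k γ Y).Nonempty → ∃ a ∈ dom k γ Y, Polymer.IsConn adj (dom k γ Y) a)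
    (hdominj : ∀ k (γ : Finset α), Set.InjOn (dom k γ) {Y | (dom k γ Y).Nonempty})
    (hε : ∀ k, 0 ≤ ε k) (hy : 0 ≤ y)
    (hdecay₀ : ∀ g ∈ W, ∀ (k : ℕ) (U : Bg) (X : C.Dom), C.scale X = k + 1 → ∀ γ' ∈ Γ.vol X,
      ∫ ω, ‖pre k (g k) U γ' ω‖ * Real.exp (boxExponent c pt β k (g k) U γ' ω) ∂(μ k (g k) U γ') ≤ ε k * y ^ γ'.card)
    (hθ : 2 * y * Real.exp (a₁ + d₁) * Real.exp (D * θ) ≤ θ) (hεθ : ∀ k, 2 * ε k * θ * ((D : ℝ) + 1) ≤ a₁)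
    (ha₁ : 0 ≤ a₁) (hκ : 0 ≤ κ) (hκd : κ ≤ d₁) (hℓ : 0 ≤ ℓ) (hτbar : 0 ≤ τbar) (hω : 0 ≤ ω)
    (hpos : 0 < ω + 4 * lipbar * a₁ * τbar) (hlam : ∀ k, lam k ≤ ℓ)
    (hτ : ∀ k j, j ≤ k → 0 ≤ τ k j ∧ τ k j ≤ τbar * ω ^ (k - j)) :
    NE9 E W κ (prodModuli ℓ fun _ => ω + 4 * lipbar * a₁ * τbar) ∧
      FadingMemory (ℓ / (ω + 4 * lipbar * a₁ * τbar)) (ω + 4 * lipbar * a₁ * τbar)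
        (prodModuli ℓ fun _ => ω + 4 * lipbar * a₁ * τbar) :=
  cubeChart_ne9_and_fadingMemory_of_pinned Γ ρ h0 hAdm hres hadd hsum hstep hfac hlast hρ hΨ hexpl hbase hNsucc hNnn
    hbox hpre hc hpt hlip hlipb hint₀ hmeet (pin_of_domainDecay D Γ.deg hαc hy₁ hθ₁ hliplb hcdec hdomconn hdominj) hε hy
    hdecay₀ hθ hεθ ha₁ hκ hκd hℓ hτbar hω hpos hlam hτ

end EndToEndDomainDecay

end Literature.MathematicalPhysics.QuantumFieldTheory.Balaban1983to89.T4HistoryLipschitzSegment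

end
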